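import Literature.MathematicalPhysics.PowerSystems.DroopSyncExponentialStability
import Literature.MathematicalPhysics.PowerSystems.StructurePreservingModel
import Literature.Analysis.ODE.RouthHurwitzLowOrder
import Literature.Analysis.ODE.KelvinTaitChetaevInstability
import HarnessLib

/-!
# Local exponential stability of the synchronous equilibria of the structure-preserving
# (Bergen–Hill) model — the mixed first/second-order «coupled oscillator model» of
# Dörfler–Chertkov–Bullo 2013 (SI Lemma 1 with Lemma 2 (2))

Topic `Literature/MathematicalPhysics/PowerSystems` (LADDER-GRIDFUSION rung G3, model row
«structure-preserving»; seat gridfusion-lit-2).  Companion of `StructurePreservingModel.lean`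
(`BergenHill n`: `M_i d²δ_i/dt² + D_i dδ_i/dt + Σ_j b_ij sin(δ_i − δ_j) = P⁰_i` at every node, `M_i > 0`
at generator internal nodes, `M_i = 0` at load buses, `D_i > 0`; `IsSolutionAt`, `IsEquilibrium`),
of `ClassicalSwingSyncExponentialStability.lean` (all nodes second order) and
`DroopSyncExponentialStability.lean` (all nodes first order).  Here the MIXED model: the state is
`(δ, ω_G)` — all bus angles and the generator speeds — on `Fin n ⊕ Gen`, `Gen = {i // M_i > 0}`, and
the theorem is proved through Lyapunov's indirect method in the rotation-quotient form
(`Literature/Analysis/ODE/LyapunovIndirectMethod.lean`).  Everything is PROVED (no named fact, no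
`sorry`).

SOURCE (held, read on the page this session): F. Dörfler, M. Chertkov, F. Bullo, PNAS 110 (2013),
Supporting Information [DorflerChertkovBullo2013; arXiv:1208.0045]: §2.1 eq. (coupled oscillator
model) (chunk p0013 L9–L26) — second-order nodes `V₁` («`M_i θ̈_i + D_i θ̇_i = ω_i − Σ_j a_ij
sin(θ_i − θ_j)`») and first-order nodes `V₂` («`D_i θ̇_i = ω_i − Σ_j …`»); §2.4 (chunk p0014): the
network-preserving power system model (generators second order, frequency-dependent loads first
order) IS this model; §3.1 **SI Lemma 1** (chunk p0016 L13–L27): for `γ ∈ [0, π/2[`, `([θ], 0_{|V₁|})`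
is a locally exponentially stable synchronization manifold of the coupled oscillator model iff `[θ]`
is one of the Kuramoto model; **SI Lemma 2 (2)** (chunk p0016 L31–L59): an equilibrium
`θ* ∈ Δ̄_G(γ)` belongs to a locally exponentially stable equilibrium manifold.  Together: an
equilibrium `θ* ∈ Δ̄_G(γ)`, `γ < π/2`, of the coupled oscillator model gives a locally exponentially
stable synchronization manifold `([θ*], 0)`.  The proof here is the direct linearisation: for every
complex eigenpair `(μ, (v, w))` of the Jacobian, `μ²⟨v, Mv⟩ + μ⟨v, Dv⟩ + ⟨v, L(θ*)v⟩ = 0` with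
`⟨v, Mv⟩ ≥ 0`, `⟨v, Dv⟩ > 0`, `⟨v, Lv⟩ = ½Σ c_ij|v_i − v_j|² ≥ 0`, hence `Re μ < 0` unless `μ = 0`
on the rotation mode; the conserved quantity `Σ_i D_iδ_i + Σ_{gen} M_iω_i` selects the rotation.

WHAT IS PROVED, for `S : BergenHill n` with `M_i ≥ 0`, `D_i > 0`, symmetric `b ≥ 0` with a connected
coupling graph, and an equilibrium `δ⁰` (`IsEquilibrium`: `Σ_j b_ij sin(δ⁰_i − δ⁰_j) = P⁰_i`) with
`|δ⁰_i − δ⁰_j| < π/2` across every line: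
* §1 `Gen`, `toDroopNetwork` (`a = b`, Laplacian `L(δ⁰)` = `DroopNetwork.lap`), `genSpeed`, `phase`,
  `spField`, `spJac`, `rot`, `weights`, row lemmas and `hasFDerivAt_spField`;
* §2 `weights_dotProduct_spField` (conserved quantity), `spField_add_rot`, `spField_equilibrium`;
* §3 **`spJac_eig_re_neg_or_rotation`** (the spectral sentence, with `M ≥ 0`);
* §4 **`expStable_within_leaf`**, **`expStable_modRotation`**, **`syncEquilibrium_locally_expStable`**
  (the tree's `IsSolutionAt δ v t`): `∃ ρ, k, λ > 0`, every solution with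
  `‖(δ(0) − δ⁰, v_G(0))‖ < ρ` satisfies `‖(δ(t) − (δ⁰ + c𝟙), v_G(t))‖ ≤ k‖(δ(0) − (δ⁰ + c𝟙), v_G(0))‖e^{−λt}`
  for `t ≥ 0`, `c = (Σ_i D_i(δ_i(0) − δ⁰_i) + Σ_{gen} M_iv_i(0))/Σ_i D_i`.

* §5 (append 2026-08-27) THE OTHER EQUILIBRIA: `exists_spJac_real_eig_pos`,
  **`unstable_of_negativeCurvature`** (state space) and **`syncEquilibrium_unstable_of_negativeCurvature`**
  (`IsSolutionAt`): an equilibrium `δᵘ` with a direction `e` of negative potential-energy curvature,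
  `Σ_i e_i Σ_j b_ij cos(δᵘ_i − δᵘ_j)(e_i − e_j) < 0`, is UNSTABLE (`M_i ≥ 0`, `D_i > 0`; the mixed pencil
  `λ²M + λD + L(δᵘ)` has a real kernel vector at some `λ > 0` —
  `Literature.Analysis.ODE.exists_pos_pencil_kernel_diagonal` — and Khalil's Theorem 4.7 part 2 in the
  general form `Literature.Analysis.ODE.unstable_of_matrix_real_eig_pos` applies).

* §6 (append 2026-08-27) THE STABLE CLAUSE OF MANIK–TIMME–WITTHAUT'S LEMMA 1 («power grid model») IN
  CERTIFICATE FORM: `spJac_eig_re_neg_or_rotation_of_posCurvature`,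
  `expStable_within_leaf_of_posCurvature`, `expStable_modRotation_of_posCurvature`,
  **`syncEquilibrium_locally_expStable_of_posCurvature`**: the equilibrium `δ⁰` need NOT lie in the
  arc and `b` need not be `≥ 0` — it suffices that the REAL Hessian form
  `u ↦ Σ_i u_i Σ_j b_ij cos(δ⁰_i − δ⁰_j)(u_i − u_j)` is `≥ 0` with kernel the constants (a transversal
  strict local minimum of the potential energy); `posCurvature_of_arc` shows §4's hypotheses are one
  such certificate; `expStable_modRotation_of_within_leaf`, `hasDerivAt_phase_of_isSolutionAt` and
  `syncEquilibrium_expStable_of_modRotation` isolate the bookkeeping (leaf → rotation → `IsSolutionAt`).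
  [ManikTimmeWitthaut2017, §2 Lemma 1]

NOT here: lossy lines, voltage dynamics (the model has `|V| = 1`), reactive power / PV buses; the
type COUNT of the other equilibria.

THREE COLUMNS.  Mathematics about MODEL «structure-preserving (Bergen–Hill), lossless,
frequency-dependent loads»; `ρ, k, λ` existential; «stable» is the sources' word about the model's
synchronous equilibrium, never about a grid.

## Mathlib / tree search

Tree: `BergenHill.{flow, IsSolutionAt, IsEquilibrium, flow_sub_const, sum_flow_eq_zero,
sum_P0_eq_zero_of_isEquilibrium}` (`StructurePreservingModel.lean`); `DroopNetwork.{a, injection,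
lap, linWeight, lap_mulVec, linWeight_symm}`; `ClassicalModel.{CouplingConnected,
exists_const_of_lineAngles_eq}`; `Literature.Analysis.ODE.exists_expStable_within_of_eig_re_neg_or_smul`;
`Literature.Analysis.ODE.RouthHurwitz.quadratic_re_neg`.  Mathlib: `Matrix.fromBlocks`,
`Fintype.sum_sum_type`, `Finset.sum_eq_single`, `hasFDerivAt_pi'`, `hasDerivAt_pi` (used).

## References

* F. Dörfler, M. Chertkov, F. Bullo, PNAS 110 (2013) 2005–2010, SI §2.1, §2.4, §3.1 Lemmas 1–2
  (arXiv:1208.0045, chunks p0013–p0016). [DorflerChertkovBullo2013]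
* K. R. Padiyar, *Structure Preserving Energy Functions in Power Systems* (2013), §3.2 eqs.
  (3.1)–(3.5) (the model, typed in `StructurePreservingModel.lean`). [Padiyar2013]
* H. K. Khalil, *Nonlinear Systems*, 3rd ed., Theorem 4.7. [Khalil2002]
* D. Manik, M. Timme, D. Witthaut, Chaos 27 (2017) 083123 = arXiv:1611.09825, §2 Lemma 1 (held
  arXiv text p0004 L46–L55: local minimum of the potential ⇔ transversally asymptotically stable,
  Kuramoto and power-grid model). [ManikTimmeWitthaut2017]
-/

noncomputable section

open Set Filter Topology Finset
open scoped Matrix ComplexConjugate BigOperators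

namespace Literature.MathematicalPhysics.PowerSystems

namespace BergenHill

variable {n : ℕ} (S : BergenHill n)

/-! ## §1 The structure-preserving model as a mixed first/second-order oscillator network -/

/-- The generator internal nodes (`M_i > 0`) as an index type. [cite: Padiyar2013, §3.2, conditions
after (3.2) («`M_i > 0` for generator nodes, `M_i = 0` for load buses»)] -/
abbrev Gen : Type := {i : Fin n // 0 < S.M i}

/-- The network data read as a first-order network: `Dc = D`, `P* = P⁰`, unit voltages, `|Y| = b`
(so `a = b`, injections = `flow`, Laplacian `L(δ⁰)` = `DroopNetwork.lap`).
[cite: DorflerChertkovBullo2013, SI §2.4 (network-preserving model as coupled oscillators)] -/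
def toDroopNetwork : DroopNetwork n where
  Dc := S.D
  Pstar := S.P0
  E := fun _ => 1
  Yabs := S.b

/-- `a = b`. [cite: DorflerChertkovBullo2013, SI §2.4] -/
theorem toDroopNetwork_a : S.toDroopNetwork.a = S.b := by
  funext i j
  simp [DroopNetwork.a, toDroopNetwork]

/-- The injections of the associated network are the nodal flows.
[cite: Padiyar2013, §3.2 eq. (3.2)] -/
theorem toDroopNetwork_injection (δ : Fin n → ℝ) (i : Fin n) :
    S.toDroopNetwork.injection δ i = S.flow δ i := by
  simp [DroopNetwork.injection, flow, toDroopNetwork_a]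

/-- The flows only see angle differences. [cite: Padiyar2013, §3.2 eq. (3.2)] -/
theorem flow_add_const (δ : Fin n → ℝ) (c : ℝ) : S.flow (fun j => δ j + c) = S.flow δ := by
  funext i
  simp only [flow, add_sub_add_right_eq_sub]

/-- The generator speed read off a state, as a function on ALL nodes (`0` at load buses).
[cite: Padiyar2013, §3.2 eq. (3.2)] -/
def genSpeed (x : Fin n ⊕ S.Gen → ℝ) (i : Fin n) : ℝ :=
  if h : 0 < S.M i then x (Sum.inr ⟨i, h⟩) else 0

/-- The state `(δ, ω_G)`: all bus angles and the generator speeds, as ONE function on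
`Fin n ⊕ Gen` (sup norm). [cite: DorflerChertkovBullo2013, SI §2.1 (state space
`𝕋ⁿ × ℝ^{|V₁|}`)] -/
def phase (δ : Fin n → ℝ) (w : S.Gen → ℝ) : Fin n ⊕ S.Gen → ℝ := Sum.elim δ w

/-- The right-hand side of the structure-preserving equations on the state space:
`δ̇_i = ω_i` at generators, `δ̇_i = (P⁰_i − Σ_j b_ij sin(δ_i − δ_j))/D_i` at load buses,
`ω̇_g = (P⁰_g − D_gω_g − Σ_j b_gj sin(δ_g − δ_j))/M_g`.
[cite: Padiyar2013, §3.2 eq. (3.2); DorflerChertkovBullo2013, SI §2.1 eq. (coupled oscillator model)] -/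
def spField (x : Fin n ⊕ S.Gen → ℝ) : Fin n ⊕ S.Gen → ℝ :=
  Sum.elim
    (fun i => if 0 < S.M i then S.genSpeed x i
      else (S.P0 i - S.flow (fun j => x (Sum.inl j)) i) / S.D i)
    (fun g => (S.P0 g.1 - S.D g.1 * x (Sum.inr g) - S.flow (fun j => x (Sum.inl j)) g.1) / S.M g.1)

/-- The rotation mode `(𝟙, 0)`. [cite: DorflerChertkovBullo2013, SI §3.1 proof of Lemma 2
(«rotational symmetry»)] -/
def rot : Fin n ⊕ S.Gen → ℝ := Sum.elim (fun _ => 1) (fun _ => 0)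

/-- The weights `(D, M_G)` of the conserved quantity `Σ_i D_iδ_i + Σ_{gen} M_iω_i`.
[cite: DorflerChertkovBullo2013, SI §2 («`ω_sync = Σ ω_i/Σ D_i`»)] -/
def weights : Fin n ⊕ S.Gen → ℝ := Sum.elim S.D (fun g => S.M g.1)

/-- **The Jacobian at an angle vector `δ⁰`** in the state `(δ, ω_G)`: load rows `−D⁻¹L(δ⁰)`,
generator angle rows pick the speed, speed rows `(−L(δ⁰)·, −D_g·)/M_g`.
[cite: DorflerChertkovBullo2013, SI §3.1 Lemma 2 (1) (Jacobian `−B diag(a_ij cos(θ_i − θ_j))Bᵀ`) and Lemma 1] -/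
def spJac (δs : Fin n → ℝ) : Matrix (Fin n ⊕ S.Gen) (Fin n ⊕ S.Gen) ℝ :=
  Matrix.fromBlocks
    (fun i j => if 0 < S.M i then 0 else -S.toDroopNetwork.lap δs i j / S.D i)
    (fun i g => if i = g.1 then 1 else 0)
    (fun g j => -S.toDroopNetwork.lap δs g.1 j / S.M g.1)
    (Matrix.diagonal fun g => -S.D g.1 / S.M g.1)

variable {S}

/-- At a generator node the generator speed is the corresponding state component. [folklore] -/
private theorem genSpeed_gen (x : Fin n ⊕ S.Gen → ℝ) (g : S.Gen) : S.genSpeed x g.1 = x (Sum.inr g) := by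
  simp [genSpeed, g.2]

/-- Rotational symmetry of the field. [cite: DorflerChertkovBullo2013, SI §3.1 proof of Lemma 2] -/
theorem spField_add_rot (x : Fin n ⊕ S.Gen → ℝ) (c : ℝ) :
    S.spField (fun k => x k + c * S.rot k) = S.spField x := by
  funext k
  cases k with
  | inl i =>
    by_cases hi : 0 < S.M i
    · simp [spField, rot, genSpeed, hi]
    · simp only [spField, rot, Sum.elim_inl, Sum.elim_inr, mul_one, if_neg hi]
      rw [flow_add_const]
  | inr g =>
    simp only [spField, rot, Sum.elim_inr, Sum.elim_inl, mul_one, mul_zero, add_zero]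
    rw [flow_add_const]

/-- The selector sum `Σ_g [i = g]·h_g` picks the generator component. [folklore] -/
private theorem sum_sel {β : Type*} [AddCommMonoid β] [Module ℝ β] (i : Fin n) (hi : 0 < S.M i)
    (h : S.Gen → β) :
    ∑ g : S.Gen, (if i = g.1 then (1 : ℝ) else 0) • h g = h ⟨i, hi⟩ := by
  rw [Finset.sum_eq_single ⟨i, hi⟩]
  · simp
  · intro g _ hg
    have : i ≠ g.1 := fun h' => hg (Subtype.ext h'.symm)
    simp [this]
  · intro h'; exact absurd (Finset.mem_univ _) h'

/-- … and vanishes at a load bus. [folklore] -/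
private theorem sum_sel_load {β : Type*} [AddCommMonoid β] [Module ℝ β] (i : Fin n)
    (hi : ¬ 0 < S.M i) (h : S.Gen → β) :
    ∑ g : S.Gen, (if i = g.1 then (1 : ℝ) else 0) • h g = 0 := by
  refine Finset.sum_eq_zero fun g _ => ?_
  have : i ≠ g.1 := fun h' => hi (h' ▸ g.2)
  simp [this]

/-- Generator angle row of the Jacobian: `(J h)_δ,i = h_ω,i`. [cite: DorflerChertkovBullo2013, SI §3.1 Lemma 1] -/
theorem spJac_mulVec_inl_gen (δs : Fin n → ℝ) (h : Fin n ⊕ S.Gen → ℝ) {i : Fin n} (hi : 0 < S.M i) :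
    (S.spJac δs *ᵥ h) (Sum.inl i) = h (Sum.inr ⟨i, hi⟩) := by
  simp only [spJac, Matrix.fromBlocks_mulVec, Sum.elim_inl, Pi.add_apply]
  simp only [Matrix.mulVec, dotProduct, if_pos hi, zero_mul, Finset.sum_const_zero, zero_add,
    Function.comp_apply]
  have := sum_sel (β := ℝ) i hi (fun g => h (Sum.inr g))
  simpa [smul_eq_mul] using this

/-- Load angle row of the Jacobian: `(J h)_δ,i = −(L(δ⁰) h_δ)_i/D_i`.
[cite: DorflerChertkovBullo2013, SI §3.1 Lemma 2 (1)] -/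
theorem spJac_mulVec_inl_load (δs : Fin n → ℝ) (h : Fin n ⊕ S.Gen → ℝ) {i : Fin n}
    (hi : ¬ 0 < S.M i) :
    (S.spJac δs *ᵥ h) (Sum.inl i)
      = -(∑ j, S.toDroopNetwork.linWeight δs i j * (h (Sum.inl i) - h (Sum.inl j))) / S.D i := by
  have hl : (S.toDroopNetwork.lap δs *ᵥ (h ∘ Sum.inl)) i
      = ∑ j, S.toDroopNetwork.linWeight δs i j * (h (Sum.inl i) - h (Sum.inl j)) := by
    rw [DroopNetwork.lap_mulVec]; rfl
  rw [← hl]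
  simp only [spJac, Matrix.fromBlocks_mulVec, Sum.elim_inl, Pi.add_apply]
  have h0 := sum_sel_load (β := ℝ) i hi (fun g => h (Sum.inr g))
  simp only [smul_eq_mul] at h0
  simp only [Matrix.mulVec, dotProduct, if_neg hi, Function.comp_apply, h0, add_zero]
  have h1 : ∀ j, -S.toDroopNetwork.lap δs i j / S.D i * h (Sum.inl j)
      = (S.toDroopNetwork.lap δs i j * h (Sum.inl j)) * (-(S.D i)⁻¹) := fun j => by ring
  simp only [h1, ← Finset.sum_mul]
  ring

/-- Speed row of the Jacobian: `(J h)_ω,g = (−(L(δ⁰) h_δ)_g − D_g h_ω,g)/M_g`.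
[cite: DorflerChertkovBullo2013, SI §3.1 Lemma 1 and Lemma 2 (1)] -/
theorem spJac_mulVec_inr (δs : Fin n → ℝ) (h : Fin n ⊕ S.Gen → ℝ) (g : S.Gen) :
    (S.spJac δs *ᵥ h) (Sum.inr g)
      = (-(∑ j, S.toDroopNetwork.linWeight δs g.1 j * (h (Sum.inl g.1) - h (Sum.inl j)))
          - S.D g.1 * h (Sum.inr g)) / S.M g.1 := by
  have hl : (S.toDroopNetwork.lap δs *ᵥ (h ∘ Sum.inl)) g.1
      = ∑ j, S.toDroopNetwork.linWeight δs g.1 j * (h (Sum.inl g.1) - h (Sum.inl j)) := by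
    rw [DroopNetwork.lap_mulVec]; rfl
  rw [← hl]
  simp only [spJac, Matrix.fromBlocks_mulVec, Sum.elim_inr, Pi.add_apply, Matrix.mulVec_diagonal,
    Function.comp_apply]
  simp only [Matrix.mulVec, dotProduct, Function.comp_apply]
  have h1 : ∀ j, -S.toDroopNetwork.lap δs g.1 j / S.M g.1 * h (Sum.inl j)
      = (S.toDroopNetwork.lap δs g.1 j * h (Sum.inl j)) * (-(S.M g.1)⁻¹) := fun j => by ring
  simp only [h1, ← Finset.sum_mul]
  ring

/-- The complexified Laplacian row. [folklore] -/
private theorem lap_map_row (δs : Fin n → ℝ) (v : Fin n ⊕ S.Gen → ℂ) (i : Fin n) :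
    ∑ j, ((S.toDroopNetwork.lap δs i j : ℝ) : ℂ) * v (Sum.inl j)
      = ∑ j, (S.toDroopNetwork.linWeight δs i j : ℂ) * (v (Sum.inl i) - v (Sum.inl j)) := by
  have hentry : ∀ j, ((S.toDroopNetwork.lap δs i j : ℝ) : ℂ)
      = (if i = j then ∑ k, (S.toDroopNetwork.linWeight δs i k : ℂ) else 0)
        - (S.toDroopNetwork.linWeight δs i j : ℂ) := by
    intro j
    simp only [DroopNetwork.lap]
    split_ifs <;> push_cast <;> ring
  simp only [hentry, sub_mul, Finset.sum_sub_distrib, ite_mul, zero_mul, Finset.sum_ite_eq,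
    Finset.mem_univ, if_true, mul_sub, Finset.sum_mul]

/-- Generator angle row, complexified. [cite: DorflerChertkovBullo2013, SI §3.1 Lemma 1] -/
theorem spJac_map_mulVec_inl_gen (δs : Fin n → ℝ) (v : Fin n ⊕ S.Gen → ℂ) {i : Fin n}
    (hi : 0 < S.M i) :
    (((S.spJac δs).map ((↑) : ℝ → ℂ)) *ᵥ v) (Sum.inl i) = v (Sum.inr ⟨i, hi⟩) := by
  have hsel : ∑ g : S.Gen, (((if i = g.1 then (1 : ℝ) else 0 : ℝ) : ℂ)) * v (Sum.inr g)
      = v (Sum.inr ⟨i, hi⟩) := by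
    have := sum_sel (β := ℂ) i hi (fun g => v (Sum.inr g))
    refine Eq.trans (Finset.sum_congr rfl fun g _ => ?_) this
    split_ifs <;> simp
  simp only [Matrix.mulVec, dotProduct, Matrix.map_apply, Fintype.sum_sum_type, spJac,
    Matrix.fromBlocks_apply₁₁, Matrix.fromBlocks_apply₁₂, if_pos hi, Complex.ofReal_zero, zero_mul,
    Finset.sum_const_zero, zero_add, hsel]

/-- Load angle row, complexified. [cite: DorflerChertkovBullo2013, SI §3.1 Lemma 2 (1)] -/
theorem spJac_map_mulVec_inl_load (δs : Fin n → ℝ) (v : Fin n ⊕ S.Gen → ℂ) {i : Fin n}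
    (hi : ¬ 0 < S.M i) :
    (((S.spJac δs).map ((↑) : ℝ → ℂ)) *ᵥ v) (Sum.inl i)
      = -(∑ j, (S.toDroopNetwork.linWeight δs i j : ℂ) * (v (Sum.inl i) - v (Sum.inl j)))
          / (S.D i : ℂ) := by
  have hsel : ∑ g : S.Gen, (((if i = g.1 then (1 : ℝ) else 0 : ℝ) : ℂ)) * v (Sum.inr g) = 0 := by
    have := sum_sel_load (β := ℂ) i hi (fun g => v (Sum.inr g))
    refine Eq.trans (Finset.sum_congr rfl fun g _ => ?_) this
    split_ifs <;> simp
  simp only [Matrix.mulVec, dotProduct, Matrix.map_apply, Fintype.sum_sum_type, spJac,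
    Matrix.fromBlocks_apply₁₁, Matrix.fromBlocks_apply₁₂, if_neg hi, hsel, add_zero]
  rw [← lap_map_row]
  have h1 : ∀ j, (((-S.toDroopNetwork.lap δs i j / S.D i : ℝ) : ℂ)) * v (Sum.inl j)
      = (((S.toDroopNetwork.lap δs i j : ℝ) : ℂ) * v (Sum.inl j)) * (-((S.D i : ℂ))⁻¹) := by
    intro j; push_cast; ring
  simp only [h1, ← Finset.sum_mul]
  ring

/-- Speed row, complexified. [cite: DorflerChertkovBullo2013, SI §3.1 Lemma 1 and Lemma 2 (1)] -/
theorem spJac_map_mulVec_inr (δs : Fin n → ℝ) (v : Fin n ⊕ S.Gen → ℂ) (g : S.Gen) :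
    (((S.spJac δs).map ((↑) : ℝ → ℂ)) *ᵥ v) (Sum.inr g)
      = (-(∑ j, (S.toDroopNetwork.linWeight δs g.1 j : ℂ) * (v (Sum.inl g.1) - v (Sum.inl j)))
          - (S.D g.1 : ℂ) * v (Sum.inr g)) / (S.M g.1 : ℂ) := by
  simp only [Matrix.mulVec, dotProduct, Matrix.map_apply, Fintype.sum_sum_type, spJac,
    Matrix.fromBlocks_apply₂₁, Matrix.fromBlocks_apply₂₂, Matrix.diagonal_apply]
  rw [← lap_map_row]
  have h1 : ∀ j, (((-S.toDroopNetwork.lap δs g.1 j / S.M g.1 : ℝ) : ℂ)) * v (Sum.inl j)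
      = (((S.toDroopNetwork.lap δs g.1 j : ℝ) : ℂ) * v (Sum.inl j)) * (-((S.M g.1 : ℂ))⁻¹) := by
    intro j; push_cast; ring
  have h2 : ∀ g' : S.Gen, ((if g = g' then -S.D g.1 / S.M g.1 else 0 : ℝ) : ℂ) * v (Sum.inr g')
      = if g = g' then -((S.D g.1 : ℂ)) / (S.M g.1 : ℂ) * v (Sum.inr g') else 0 := by
    intro g'; split_ifs <;> push_cast <;> ring
  simp only [h1, h2, ← Finset.sum_mul, Finset.sum_ite_eq, Finset.mem_univ, if_true]
  ring

/-- **The linearisation IS the Jacobian**: the structure-preserving field has Fréchet derivative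
`toLin' (spJac δ⁰)` at every state `(δ⁰, ω₀)`.
[cite: DorflerChertkovBullo2013, SI §3.1 Lemma 2 (1) and Lemma 1] -/
theorem hasFDerivAt_spField (δs : Fin n → ℝ) (w₀ : S.Gen → ℝ) :
    HasFDerivAt S.spField (LinearMap.toContinuousLinearMap (Matrix.toLin' (S.spJac δs)))
      (S.phase δs w₀) := by
  rw [hasFDerivAt_pi']
  set x₀ : Fin n ⊕ S.Gen → ℝ := S.phase δs w₀ with hx₀
  have hproj : ∀ k : Fin n ⊕ S.Gen, HasFDerivAt (fun x : Fin n ⊕ S.Gen → ℝ => x k)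
      (ContinuousLinearMap.proj k : (Fin n ⊕ S.Gen → ℝ) →L[ℝ] ℝ) x₀ := fun k => hasFDerivAt_apply k _
  -- the flow rows: derivative of `x ↦ Σ_j b_ij sin(x_δ,i − x_δ,j)`
  have hflow : ∀ i : Fin n, HasFDerivAt
      (fun x : Fin n ⊕ S.Gen → ℝ => S.flow (fun j => x (Sum.inl j)) i)
      (∑ j, S.b i j • (Real.cos (δs i - δs j) •
        ((ContinuousLinearMap.proj (Sum.inl i) : (Fin n ⊕ S.Gen → ℝ) →L[ℝ] ℝ)
          - ContinuousLinearMap.proj (Sum.inl j)))) x₀ := by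
    intro i
    have hdiff : ∀ j : Fin n, HasFDerivAt (fun x : Fin n ⊕ S.Gen → ℝ => x (Sum.inl i) - x (Sum.inl j))
        ((ContinuousLinearMap.proj (Sum.inl i) : (Fin n ⊕ S.Gen → ℝ) →L[ℝ] ℝ)
          - ContinuousLinearMap.proj (Sum.inl j)) x₀ :=
      fun j => (hproj (Sum.inl i)).fun_sub (hproj (Sum.inl j))
    have hsin : ∀ j : Fin n, HasFDerivAt
        (fun x : Fin n ⊕ S.Gen → ℝ => S.b i j * Real.sin (x (Sum.inl i) - x (Sum.inl j)))
        (S.b i j • (Real.cos (δs i - δs j) •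
          ((ContinuousLinearMap.proj (Sum.inl i) : (Fin n ⊕ S.Gen → ℝ) →L[ℝ] ℝ)
            - ContinuousLinearMap.proj (Sum.inl j)))) x₀ := fun j => by
      have h1 := (hdiff j).sin
      have hval : x₀ (Sum.inl i) - x₀ (Sum.inl j) = δs i - δs j := by simp [hx₀, phase]
      rw [hval] at h1
      exact h1.const_mul (S.b i j)
    have := HasFDerivAt.fun_sum (u := Finset.univ) fun j _ => hsin j
    refine this.congr_of_eventuallyEq (Eventually.of_forall fun x => ?_)
    simp [flow]
  have hflow_apply : ∀ (i : Fin n) (h : Fin n ⊕ S.Gen → ℝ),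
      ((∑ j, S.b i j • (Real.cos (δs i - δs j) •
        ((ContinuousLinearMap.proj (Sum.inl i) : (Fin n ⊕ S.Gen → ℝ) →L[ℝ] ℝ)
          - ContinuousLinearMap.proj (Sum.inl j))) : (Fin n ⊕ S.Gen → ℝ) →L[ℝ] ℝ)) h
        = ∑ j, S.toDroopNetwork.linWeight δs i j * (h (Sum.inl i) - h (Sum.inl j)) := by
    intro i h
    simp only [_root_.sum_apply, smul_apply, sub_apply, ContinuousLinearMap.proj_apply, smul_eq_mul,
      DroopNetwork.linWeight, toDroopNetwork_a]
    refine Finset.sum_congr rfl fun j _ => ?_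
    ring
  intro k
  cases k with
  | inl i =>
    by_cases hi : 0 < S.M i
    · -- generator angle row: `x ↦ x_ω,i`
      refine (hproj (Sum.inr ⟨i, hi⟩)).congr_of_eventuallyEq
        (Eventually.of_forall fun x => by simp [spField, hi, genSpeed]) |>.congr_fderiv
        (ContinuousLinearMap.ext fun h => ?_)
      simp only [ContinuousLinearMap.comp_apply, LinearMap.coe_toContinuousLinearMap',
        Matrix.toLin'_apply, ContinuousLinearMap.proj_apply, spJac_mulVec_inl_gen δs h hi]
    · -- load angle row: `x ↦ (P⁰_i − flow_i(x_δ))/D_i`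
      have hF : HasFDerivAt (fun x : Fin n ⊕ S.Gen → ℝ => S.spField x (Sum.inl i))
          ((S.D i)⁻¹ • ((0 : (Fin n ⊕ S.Gen → ℝ) →L[ℝ] ℝ)
            - ∑ j, S.b i j • (Real.cos (δs i - δs j) •
              ((ContinuousLinearMap.proj (Sum.inl i) : (Fin n ⊕ S.Gen → ℝ) →L[ℝ] ℝ)
                - ContinuousLinearMap.proj (Sum.inl j))))) x₀ := by
        have h1 := ((hasFDerivAt_const (S.P0 i) x₀).sub (hflow i)).const_mul (S.D i)⁻¹
        refine h1.congr_of_eventuallyEq (Eventually.of_forall fun x => ?_)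
        simp only [Pi.sub_apply, spField, Sum.elim_inl, if_neg hi, div_eq_inv_mul]
      refine hF.congr_fderiv (ContinuousLinearMap.ext fun h => ?_)
      rw [ContinuousLinearMap.comp_apply, LinearMap.coe_toContinuousLinearMap', Matrix.toLin'_apply,
        ContinuousLinearMap.proj_apply, spJac_mulVec_inl_load δs h hi]
      simp only [smul_apply, sub_apply, zero_apply, smul_eq_mul, hflow_apply]
      ring
  | inr g =>
    have hω : HasFDerivAt (fun x : Fin n ⊕ S.Gen → ℝ => S.D g.1 * x (Sum.inr g))
        (S.D g.1 • (ContinuousLinearMap.proj (Sum.inr g) : (Fin n ⊕ S.Gen → ℝ) →L[ℝ] ℝ)) x₀ :=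
      (hproj (Sum.inr g)).const_mul (S.D g.1)
    have hF : HasFDerivAt (fun x : Fin n ⊕ S.Gen → ℝ => S.spField x (Sum.inr g))
        ((S.M g.1)⁻¹ • ((0 : (Fin n ⊕ S.Gen → ℝ) →L[ℝ] ℝ)
          - S.D g.1 • (ContinuousLinearMap.proj (Sum.inr g) : (Fin n ⊕ S.Gen → ℝ) →L[ℝ] ℝ)
          - ∑ j, S.b g.1 j • (Real.cos (δs g.1 - δs j) •
              ((ContinuousLinearMap.proj (Sum.inl g.1) : (Fin n ⊕ S.Gen → ℝ) →L[ℝ] ℝ)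
                - ContinuousLinearMap.proj (Sum.inl j))))) x₀ := by
      have h1 := (((hasFDerivAt_const (S.P0 g.1) x₀).sub hω).sub (hflow g.1)).const_mul (S.M g.1)⁻¹
      refine h1.congr_of_eventuallyEq (Eventually.of_forall fun x => ?_)
      simp only [Pi.sub_apply, spField, Sum.elim_inr, div_eq_inv_mul]
    refine hF.congr_fderiv (ContinuousLinearMap.ext fun h => ?_)
    rw [ContinuousLinearMap.comp_apply, LinearMap.coe_toContinuousLinearMap', Matrix.toLin'_apply,
      ContinuousLinearMap.proj_apply, spJac_mulVec_inr]
    simp only [smul_apply, sub_apply, zero_apply, ContinuousLinearMap.proj_apply, smul_eq_mul,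
      hflow_apply]
    ring

/-- At an equilibrium angle vector the field vanishes at `(δ⁰, 0)`. [cite: Padiyar2013, §3.2 eq. (3.12)] -/
theorem spField_equilibrium {δ0 : Fin n → ℝ} (hδ0 : S.IsEquilibrium δ0) :
    S.spField (S.phase δ0 fun _ => 0) = 0 := by
  funext k
  cases k with
  | inl i =>
    by_cases hi : 0 < S.M i
    · simp [spField, phase, genSpeed, hi]
    · simp only [spField, phase, Sum.elim_inl, if_neg hi, Pi.zero_apply]
      rw [hδ0 i, sub_self, zero_div]
  | inr g =>
    simp only [spField, phase, Sum.elim_inr, Sum.elim_inl, mul_zero, sub_zero, Pi.zero_apply]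
    rw [hδ0 g.1, sub_self, zero_div]

/-! ## §2 The conserved quantity `Σ_i D_iδ_i + Σ_{gen} M_iω_i` -/

/-- **The conserved quantity**: along the structure-preserving equations
`d/dt (Σ_i D_iδ_i + Σ_{gen} M_iω_i) = Σ_i (P⁰_i − Σ_j b_ij sin(δ_i − δ_j)) = Σ_i P⁰_i = 0` when the
injections balance. [cite: DorflerChertkovBullo2013, SI §2 (summing the equations; `ω_sync = Σω_i/ΣD_i`)] -/
theorem weights_dotProduct_spField (hD : ∀ i, S.D i ≠ 0) (hb : ∀ i j, S.b i j = S.b j i)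
    (hbal : ∑ i, S.P0 i = 0) (x : Fin n ⊕ S.Gen → ℝ) : S.weights ⬝ᵥ S.spField x = 0 := by
  -- nodewise bookkeeping: `D_i δ̇_i + [i gen] M_i ω̇_i = P⁰_i − flow_i`
  set f : Fin n → ℝ := fun i =>
    if 0 < S.M i then S.P0 i - S.D i * S.genSpeed x i - S.flow (fun j => x (Sum.inl j)) i else 0
    with hf
  have hgen : ∑ g : S.Gen, S.M g.1 * S.spField x (Sum.inr g) = ∑ i, f i := by
    have h1 : ∀ g : S.Gen, S.M g.1 * S.spField x (Sum.inr g) = f g.1 := by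
      intro g
      simp only [spField, Sum.elim_inr, hf, if_pos g.2, genSpeed_gen]
      field_simp [g.2.ne']
    simp only [h1]
    have hsub : ∑ i ∈ Finset.univ.filter (fun i => 0 < S.M i), f i = ∑ g : S.Gen, f g.1 :=
      Finset.sum_subtype _ (fun i => by simp) f
    rw [← hsub, Finset.sum_filter]
    refine Finset.sum_congr rfl fun i _ => ?_
    by_cases hi : 0 < S.M i
    · rw [if_pos hi]
    · rw [if_neg hi, hf]; simp [hi]
  have hnode : ∀ i, S.D i * S.spField x (Sum.inl i) + f i
      = S.P0 i - S.flow (fun j => x (Sum.inl j)) i := by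
    intro i
    by_cases hi : 0 < S.M i
    · simp only [spField, Sum.elim_inl, if_pos hi, hf]
      ring
    · simp only [spField, Sum.elim_inl, if_neg hi, hf]
      field_simp [hD i]
      ring
  calc S.weights ⬝ᵥ S.spField x
      = ∑ i, S.D i * S.spField x (Sum.inl i) + ∑ g : S.Gen, S.M g.1 * S.spField x (Sum.inr g) := by
        simp [dotProduct, Fintype.sum_sum_type, weights]
    _ = ∑ i, (S.D i * S.spField x (Sum.inl i) + f i) := by
        rw [hgen, ← Finset.sum_add_distrib]
    _ = ∑ i, (S.P0 i - S.flow (fun j => x (Sum.inl j)) i) := Finset.sum_congr rfl fun i _ => hnode i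
    _ = 0 := by rw [Finset.sum_sub_distrib, hbal, S.sum_flow_eq_zero hb, sub_self]

/-- `Σ (D, M_G) · (𝟙, 0) = Σ_i D_i`. [folklore] -/
private theorem weights_dotProduct_rot : S.weights ⬝ᵥ S.rot = ∑ i, S.D i := by
  simp [dotProduct, Fintype.sum_sum_type, weights, rot]

/-! ## §3 The spectrum of the Jacobian: left half-plane except the rotation mode -/

/-- Complex vector constant across every line of a connected graph ⇒ complex multiple of `𝟙`
(private copy of the helper of `DroopSyncExponentialStability.lean`). [folklore] -/
private theorem exists_eq_const_of_lines' {c : Fin n → Fin n → ℝ}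
    (hconn : ClassicalModel.CouplingConnected c) {v : Fin n → ℂ}
    (h : ∀ i j, i ≠ j → 0 < c i j → v i = v j) : ∃ a : ℂ, v = fun _ => a := by
  obtain ⟨cr, hcr⟩ := ClassicalModel.exists_const_of_lineAngles_eq hconn (θ := fun _ => (0 : ℝ))
    (θ' := fun i => (v i).re) (fun i j hij hc => by simp [h i j hij hc])
  obtain ⟨ci, hci⟩ := ClassicalModel.exists_const_of_lineAngles_eq hconn (θ := fun _ => (0 : ℝ))
    (θ' := fun i => (v i).im) (fun i j hij hc => by simp [h i j hij hc])
  refine ⟨⟨cr, ci⟩, funext fun i => Complex.ext ?_ ?_⟩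
  · simpa using hcr i
  · simpa using hci i

/-- The Laplacian quadratic form over `ℂ` (private copy of the helper of
`DroopSyncExponentialStability.lean`). [folklore] -/
private theorem conj_lap_form' {c : Fin n → Fin n → ℝ} (hc : ∀ i j, c i j = c j i) (v : Fin n → ℂ) :
    2 * ∑ i, conj (v i) * ∑ j, (c i j : ℂ) * (v i - v j)
      = ((∑ i, ∑ j, c i j * ‖v i - v j‖ ^ 2 : ℝ) : ℂ) := by
  have hS : ∑ i, conj (v i) * ∑ j, (c i j : ℂ) * (v i - v j)
      = ∑ i, ∑ j, (c i j : ℂ) * (conj (v i) * (v i - v j)) := by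
    refine Finset.sum_congr rfl fun i _ => ?_
    rw [Finset.mul_sum]
    refine Finset.sum_congr rfl fun j _ => ?_
    ring
  have hS' : ∑ i, ∑ j, (c i j : ℂ) * (conj (v i) * (v i - v j))
      = ∑ i, ∑ j, (c i j : ℂ) * (conj (v j) * (v j - v i)) := by
    rw [Finset.sum_comm]
    refine Finset.sum_congr rfl fun i _ => Finset.sum_congr rfl fun j _ => ?_
    rw [hc j i]
  rw [two_mul, hS]
  conv_lhs => arg 2; rw [hS']
  push_cast
  rw [← Finset.sum_add_distrib]
  refine Finset.sum_congr rfl fun i _ => ?_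
  rw [← Finset.sum_add_distrib]
  refine Finset.sum_congr rfl fun j _ => ?_
  rw [← Complex.conj_mul' (v i - v j), map_sub]
  ring

/-- **The mixed-order spectral lemma** (`M_i ≥ 0`): for symmetric weights `c_ij ≥ 0` with a
connected graph, `D_i > 0`, `M_i ≥ 0`: if `v ≠ 0` and `μ²M_iv_i + μD_iv_i + Σ_j c_ij(v_i − v_j) = 0`
for every `i`, then `Re μ < 0`, or `μ = 0` and `v` is a complex multiple of `𝟙`. [folklore] -/
private theorem mixedOrder_eig {c : Fin n → Fin n → ℝ} {D M : Fin n → ℝ}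
    (hc : ∀ i j, c i j = c j i) (hc0 : ∀ i j, i ≠ j → 0 ≤ c i j)
    (hconn : ClassicalModel.CouplingConnected c) (hD : ∀ i, 0 < D i) (hM : ∀ i, 0 ≤ M i)
    {μ : ℂ} {v : Fin n → ℂ} (hv : v ≠ 0)
    (hrow : ∀ i, -(∑ j, (c i j : ℂ) * (v i - v j)) = μ * (D i : ℂ) * v i + μ ^ 2 * (M i : ℂ) * v i) :
    μ.re < 0 ∨ (μ = 0 ∧ ∃ a : ℂ, v = fun _ => a) := by
  set Q : ℝ := ∑ i, ∑ j, c i j * ‖v i - v j‖ ^ 2 with hQ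
  set Nd : ℝ := ∑ i, D i * ‖v i‖ ^ 2 with hNd
  set Nm : ℝ := ∑ i, M i * ‖v i‖ ^ 2 with hNm
  have hQ0 : 0 ≤ Q := by
    refine Finset.sum_nonneg fun i _ => Finset.sum_nonneg fun j _ => ?_
    by_cases hij : i = j
    · subst hij; simp
    · exact mul_nonneg (hc0 i j hij) (sq_nonneg _)
  have hNm0 : 0 ≤ Nm := Finset.sum_nonneg fun i _ => mul_nonneg (hM i) (sq_nonneg _)
  obtain ⟨i0, hi0⟩ : ∃ i, v i ≠ 0 := by
    by_contra hcon
    push Not at hcon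
    exact hv (funext hcon)
  have hNd0 : 0 < Nd := by
    have hterm : ∀ j ∈ (Finset.univ : Finset (Fin n)), 0 ≤ D j * ‖v j‖ ^ 2 :=
      fun j _ => mul_nonneg (hD j).le (sq_nonneg _)
    exact lt_of_lt_of_le (mul_pos (hD i0) (by positivity))
      (Finset.single_le_sum hterm (Finset.mem_univ i0))
  have hsum : -(∑ i, conj (v i) * ∑ j, (c i j : ℂ) * (v i - v j))
      = μ * (Nd : ℂ) + μ ^ 2 * (Nm : ℂ) := by
    have e1 : ∑ i, conj (v i) * -(∑ j, (c i j : ℂ) * (v i - v j))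
        = ∑ i, conj (v i) * (μ * (D i : ℂ) * v i + μ ^ 2 * (M i : ℂ) * v i) :=
      Finset.sum_congr rfl fun i _ => by rw [hrow i]
    have e2 : ∑ i, conj (v i) * (μ * (D i : ℂ) * v i + μ ^ 2 * (M i : ℂ) * v i)
        = μ * (Nd : ℂ) + μ ^ 2 * (Nm : ℂ) := by
      rw [hNd, hNm]
      push_cast
      rw [Finset.mul_sum, Finset.mul_sum, ← Finset.sum_add_distrib]
      refine Finset.sum_congr rfl fun i _ => ?_
      rw [← Complex.conj_mul' (v i)]
      ring
    rw [← e2, ← e1]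
    simp [Finset.sum_neg_distrib, mul_neg]
  have hkey : μ ^ 2 * (Nm : ℂ) + μ * (Nd : ℂ) + (Q : ℂ) / 2 = 0 := by
    have h := conj_lap_form' hc v
    linear_combination (-1 : ℂ) * hsum - (1 / 2 : ℂ) * h
  -- real and imaginary parts of the quadratic relation
  have hre : (μ.re * μ.re - μ.im * μ.im) * Nm + μ.re * Nd + Q / 2 = 0 := by
    have := congrArg Complex.re hkey
    simp [pow_two, Complex.mul_re] at this
    linarith
  have him : (2 * μ.re * μ.im) * Nm + μ.im * Nd = 0 := by
    have := congrArg Complex.im hkey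
    simp [pow_two, Complex.mul_im, Complex.mul_re] at this
    linarith
  -- the constancy argument when `Q = 0`
  have hconst : Q = 0 → ∃ a : ℂ, v = fun _ => a := by
    intro hQzero
    have hterms : ∀ i j, i ≠ j → 0 < c i j → v i = v j := by
      intro i j hij hcij
      have hnn : ∀ i ∈ (Finset.univ : Finset (Fin n)), 0 ≤ ∑ j, c i j * ‖v i - v j‖ ^ 2 :=
        fun i _ => Finset.sum_nonneg fun j _ => by
          by_cases hij : i = j
          · subst hij; simp
          · exact mul_nonneg (hc0 i j hij) (sq_nonneg _)
      have hrow0 := (Finset.sum_eq_zero_iff_of_nonneg hnn).1 hQzero i (Finset.mem_univ i)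
      have hnn' : ∀ j ∈ (Finset.univ : Finset (Fin n)), 0 ≤ c i j * ‖v i - v j‖ ^ 2 :=
        fun j _ => by
          by_cases hij : i = j
          · subst hij; simp
          · exact mul_nonneg (hc0 i j hij) (sq_nonneg _)
      have hij0 := (Finset.sum_eq_zero_iff_of_nonneg hnn').1 hrow0 j (Finset.mem_univ j)
      rcases mul_eq_zero.1 hij0 with h0 | h0
      · exact absurd h0 hcij.ne'
      · have : ‖v i - v j‖ = 0 := by simpa using h0
        exact sub_eq_zero.1 (norm_eq_zero.1 this)
    exact exists_eq_const_of_lines' hconn hterms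
  -- case analysis on the imaginary part: `μ.im (2 μ.re Nm + Nd) = 0`
  have him' : μ.im * (2 * μ.re * Nm + Nd) = 0 := by linarith [him]
  rcases mul_eq_zero.1 him' with him0 | hfac
  · -- `μ` real: `a² Nm + a Nd + Q/2 = 0`
    have hre' : μ.re * μ.re * Nm + μ.re * Nd + Q / 2 = 0 := by rw [him0] at hre; linarith
    by_cases ha : μ.re < 0
    · exact Or.inl ha
    · push Not at ha
      -- all three terms nonnegative ⇒ all zero ⇒ `μ.re = 0`, `Q = 0`
      have h1 : 0 ≤ μ.re * μ.re * Nm := by positivity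
      have h2 : 0 ≤ μ.re * Nd := by positivity
      have hQz : Q = 0 := by linarith
      have hare : μ.re = 0 := by nlinarith
      right
      refine ⟨Complex.ext (by simpa using hare) (by simpa using him0), hconst hQz⟩
  · -- `2 μ.re Nm + Nd = 0` with `Nd > 0`, `Nm ≥ 0` forces `μ.re < 0`
    left
    nlinarith

/-- **The spectral sentence of the structure-preserving linearisation, PROVED**: `M_i ≥ 0`,
`D_i > 0`, symmetric `b ≥ 0` with a connected coupling graph, an angle vector `δ⁰` in the arc: every
complex eigenpair `(μ, v)` of `spJac δ⁰` has `Re μ < 0`, or `μ = 0` and `v` is a complex multiple of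
the rotation mode `(𝟙, 0)`. [cite: DorflerChertkovBullo2013, SI §3.1 Lemma 1 with proof of Lemma 2 (2)] -/
theorem spJac_eig_re_neg_or_rotation (hM : ∀ i, 0 ≤ S.M i) (hD : ∀ i, 0 < S.D i)
    (hb : ∀ i j, S.b i j = S.b j i) (hb0 : ∀ i j, 0 ≤ S.b i j)
    (hconn : ClassicalModel.CouplingConnected S.b) {δs : Fin n → ℝ}
    (harc : ∀ i j, i ≠ j → 0 < S.b i j → |δs i - δs j| < Real.pi / 2)
    {μ : ℂ} {v : Fin n ⊕ S.Gen → ℂ} (hv : v ≠ 0)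
    (hJ : (S.spJac δs).map ((↑) : ℝ → ℂ) *ᵥ v = μ • v) :
    μ.re < 0 ∨ (μ = 0 ∧ ∃ a : ℂ, v = fun k => a * (S.rot k : ℂ)) := by
  set c : Fin n → Fin n → ℝ := S.toDroopNetwork.linWeight δs with hcdef
  have hc : ∀ i j, c i j = c j i := DroopNetwork.linWeight_symm (N := S.toDroopNetwork) hb δs
  have hc0 : ∀ i j, i ≠ j → 0 ≤ c i j := by
    intro i j hij
    simp only [hcdef, DroopNetwork.linWeight, toDroopNetwork_a]
    rcases (hb0 i j).lt_or_eq with hpos | hzero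
    · exact mul_nonneg (hb0 i j) (Real.cos_nonneg_of_mem_Icc
        ⟨by linarith [abs_lt.1 (harc i j hij hpos)], by linarith [abs_lt.1 (harc i j hij hpos)]⟩)
    · rw [← hzero]; simp
  have hconn' : ClassicalModel.CouplingConnected c := by
    intro T hT hTc
    obtain ⟨i, hi, j, hj, hpos⟩ := hconn T hT hTc
    have hij : i ≠ j := by rintro rfl; exact (Finset.mem_compl.1 hj) hi
    refine ⟨i, hi, j, hj, ?_⟩
    simp only [hcdef, DroopNetwork.linWeight, toDroopNetwork_a]
    have hlt := abs_lt.1 (harc i j hij hpos)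
    exact mul_pos hpos (Real.cos_pos_of_mem_Ioo ⟨by linarith, by linarith⟩)
  -- the `δ`-part of the eigenvector and the row relations
  set v₁ : Fin n → ℂ := fun i => v (Sum.inl i) with hv₁
  have hgenrow : ∀ g : S.Gen, v (Sum.inr g) = μ * v₁ g.1 := by
    intro g
    have := congrFun hJ (Sum.inl g.1)
    rw [spJac_map_mulVec_inl_gen δs v g.2] at this
    simpa using this
  have hrow : ∀ i, -(∑ j, (c i j : ℂ) * (v₁ i - v₁ j))
      = μ * (S.D i : ℂ) * v₁ i + μ ^ 2 * (S.M i : ℂ) * v₁ i := by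
    intro i
    by_cases hi : 0 < S.M i
    · have h2 := congrFun hJ (Sum.inr ⟨i, hi⟩)
      rw [spJac_map_mulVec_inr] at h2
      have hMi : (S.M i : ℂ) ≠ 0 := by exact_mod_cast hi.ne'
      simp only [Pi.smul_apply, smul_eq_mul] at h2
      rw [div_eq_iff hMi, hgenrow ⟨i, hi⟩] at h2
      simp only [hcdef, hv₁]
      linear_combination h2
    · have h2 := congrFun hJ (Sum.inl i)
      rw [spJac_map_mulVec_inl_load δs v hi] at h2
      have hDi : (S.D i : ℂ) ≠ 0 := by exact_mod_cast (hD i).ne'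
      simp only [Pi.smul_apply, smul_eq_mul] at h2
      rw [div_eq_iff hDi] at h2
      have hM0 : S.M i = 0 := le_antisymm (not_lt.1 hi) (hM i)
      simp only [hcdef, hv₁, hM0, Complex.ofReal_zero, mul_zero, zero_mul, add_zero]
      linear_combination h2
  have hv₁0 : v₁ ≠ 0 := by
    intro h0
    apply hv
    funext k
    cases k with
    | inl i => exact congrFun h0 i
    | inr g => rw [hgenrow g, h0]; simp
  rcases mixedOrder_eig hc hc0 hconn' hD hM hv₁0 hrow with hre | ⟨hμ0, a, ha⟩
  · exact Or.inl hre
  · refine Or.inr ⟨hμ0, a, funext fun k => ?_⟩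
    cases k with
    | inl i => simpa [rot] using congrFun ha i
    | inr g => simp [rot, hgenrow g, hμ0]

/-! ## §4 Local exponential stability of the synchronous equilibrium (modulo rotation) -/

/-- **LES within a leaf of the conserved quantity.** [cite: DorflerChertkovBullo2013, SI §3.1
Lemmas 1–2 («locally (transversally) exponentially stable»)] -/
theorem expStable_within_leaf (hM : ∀ i, 0 ≤ S.M i) (hD : ∀ i, 0 < S.D i)
    (hb : ∀ i j, S.b i j = S.b j i) (hb0 : ∀ i j, 0 ≤ S.b i j)
    (hconn : ClassicalModel.CouplingConnected S.b) {δ0 : Fin n → ℝ} (hδ0 : S.IsEquilibrium δ0)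
    (harc : ∀ i j, i ≠ j → 0 < S.b i j → |δ0 i - δ0 j| < Real.pi / 2) :
    ∃ ρ > 0, ∃ k > 0, ∃ lam > 0, ∀ (X : ℝ → Fin n ⊕ S.Gen → ℝ) (T : ℝ),
      (∀ t ∈ Icc 0 T, HasDerivWithinAt X (S.spField (X t)) (Icc 0 T) t) →
      S.weights ⬝ᵥ X 0 = S.weights ⬝ᵥ S.phase δ0 (fun _ => 0) →
      ‖X 0 - S.phase δ0 (fun _ => 0)‖ < ρ →
      ∀ t ∈ Icc 0 T, ‖X t - S.phase δ0 (fun _ => 0)‖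
        ≤ k * ‖X 0 - S.phase δ0 (fun _ => 0)‖ * Real.exp (-lam * t) := by
  rcases isEmpty_or_nonempty (Fin n) with hn | hn
  · refine ⟨1, one_pos, 1, one_pos, 1, one_pos, fun X T _ _ _ t _ => ?_⟩
    have : X t - S.phase δ0 (fun _ => 0) = 0 := funext fun k => by
      cases k with
      | inl i => exact (IsEmpty.false i).elim
      | inr g => exact (IsEmpty.false g.1).elim
    rw [this, norm_zero]
    positivity
  have hDs : 0 < ∑ i, S.D i := Finset.sum_pos (fun i _ => hD i) Finset.univ_nonempty
  have hlr : S.weights ⬝ᵥ S.rot ≠ 0 := by rw [weights_dotProduct_rot]; exact hDs.ne'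
  have hbal := S.sum_P0_eq_zero_of_isEquilibrium hb hδ0
  exact Literature.Analysis.ODE.exists_expStable_within_of_eig_re_neg_or_smul
    (hasFDerivAt_spField δ0 fun _ => 0) (spField_equilibrium hδ0)
    (fun x => weights_dotProduct_spField (fun i => (hD i).ne') hb hbal x) hlr
    (fun μ v hv hJ => spJac_eig_re_neg_or_rotation hM hD hb hb0 hconn harc hv hJ)

/-- `|Σ(D, M_G)·h| ≤ (Σ weights)‖h‖` (sup norm). [folklore] -/
private theorem abs_weights_dotProduct_le (hD : ∀ i, 0 ≤ S.D i) (hM : ∀ i, 0 ≤ S.M i)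
    (h : Fin n ⊕ S.Gen → ℝ) :
    |S.weights ⬝ᵥ h| ≤ (∑ k, S.weights k) * ‖h‖ := by
  have hw : ∀ k, 0 ≤ S.weights k := fun k => by
    cases k with
    | inl i => exact hD i
    | inr g => exact hM g.1
  calc |S.weights ⬝ᵥ h| = |∑ k, S.weights k * h k| := rfl
    _ ≤ ∑ k, |S.weights k * h k| := Finset.abs_sum_le_sum_abs _ _
    _ ≤ ∑ k, S.weights k * ‖h‖ := Finset.sum_le_sum fun k _ => by
        rw [abs_mul, abs_of_nonneg (hw k)]
        exact mul_le_mul_of_nonneg_left (by simpa using norm_le_pi_norm h k) (hw k)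
    _ = (∑ k, S.weights k) * ‖h‖ := by rw [Finset.sum_mul]

/-- **The synchronous equilibrium is locally exponentially stable modulo rotation** (state-space
form): every solution `X` of `X' = spField X` on `[0, T]` with `‖X(0) − (δ⁰, 0)‖ < ρ` satisfies
`‖X(t) − (δ⁰ + c𝟙, 0)‖ ≤ k‖X(0) − (δ⁰ + c𝟙, 0)‖e^{−λt}`, `c = (Σ_i D_i(δ_i(0) − δ⁰_i) +
Σ_{gen} M_iω_i(0))/Σ_i D_i`. [cite: DorflerChertkovBullo2013, SI §3.1 Lemma 1 (ii) with Lemma 2 (2)] -/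
theorem expStable_modRotation (hM : ∀ i, 0 ≤ S.M i) (hD : ∀ i, 0 < S.D i)
    (hb : ∀ i j, S.b i j = S.b j i) (hb0 : ∀ i j, 0 ≤ S.b i j)
    (hconn : ClassicalModel.CouplingConnected S.b) {δ0 : Fin n → ℝ} (hδ0 : S.IsEquilibrium δ0)
    (harc : ∀ i j, i ≠ j → 0 < S.b i j → |δ0 i - δ0 j| < Real.pi / 2) :
    ∃ ρ > 0, ∃ k > 0, ∃ lam > 0, ∀ (X : ℝ → Fin n ⊕ S.Gen → ℝ) (T : ℝ),
      (∀ t ∈ Icc 0 T, HasDerivWithinAt X (S.spField (X t)) (Icc 0 T) t) →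
      ‖X 0 - S.phase δ0 (fun _ => 0)‖ < ρ →
      ∀ t ∈ Icc 0 T,
        ‖X t - fun k => S.phase δ0 (fun _ => 0) k
            + S.weights ⬝ᵥ (X 0 - S.phase δ0 (fun _ => 0)) / (∑ i, S.D i) * S.rot k‖
          ≤ k * ‖X 0 - fun k => S.phase δ0 (fun _ => 0) k
              + S.weights ⬝ᵥ (X 0 - S.phase δ0 (fun _ => 0)) / (∑ i, S.D i) * S.rot k‖
            * Real.exp (-lam * t) := by
  obtain ⟨ρ, hρ, k, hk, lam, hlam, H⟩ := expStable_within_leaf hM hD hb hb0 hconn hδ0 harc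
  rcases isEmpty_or_nonempty (Fin n) with hn | hn
  · refine ⟨1, one_pos, 1, one_pos, 1, one_pos, fun X T _ _ t _ => ?_⟩
    have h0 : ∀ s, (X s - fun k => S.phase δ0 (fun _ => 0) k
        + S.weights ⬝ᵥ (X 0 - S.phase δ0 (fun _ => 0)) / (∑ i, S.D i) * S.rot k) = 0 :=
      fun s => funext fun k => by
        cases k with
        | inl i => exact (IsEmpty.false i).elim
        | inr g => exact (IsEmpty.false g.1).elim
    rw [h0 t, h0 0, norm_zero]
    simp
  have hDs : 0 < ∑ i, S.D i := Finset.sum_pos (fun i _ => hD i) Finset.univ_nonempty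
  set K : ℝ := (∑ k, S.weights k) / ∑ i, S.D i with hKdef
  have hK0 : 0 ≤ K := div_nonneg (Finset.sum_nonneg fun k _ => by
    cases k with
    | inl i => exact (hD i).le
    | inr g => exact hM g.1) hDs.le
  refine ⟨ρ / (1 + K), by positivity, k, hk, lam, hlam, fun X T hX h0 t ht => ?_⟩
  set x₀ : Fin n ⊕ S.Gen → ℝ := S.phase δ0 (fun _ => 0) with hx₀
  set c : ℝ := S.weights ⬝ᵥ (X 0 - x₀) / ∑ i, S.D i with hcdef
  set Y : ℝ → Fin n ⊕ S.Gen → ℝ := fun s k => X s k - c * S.rot k with hYdef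
  have hYsol : ∀ s ∈ Icc 0 T, HasDerivWithinAt Y (S.spField (Y s)) (Icc 0 T) s := by
    intro s hs
    have h1 : HasDerivWithinAt Y (S.spField (X s) - 0) (Icc 0 T) s :=
      (hX s hs).sub (hasDerivWithinAt_const s (Icc 0 T) (fun k : Fin n ⊕ S.Gen => c * S.rot k))
    have h2 : S.spField (Y s) = S.spField (X s) := by
      have := spField_add_rot (S := S) (X s) (-c)
      simpa [hYdef, sub_eq_add_neg, neg_mul] using this
    rw [h2, ← sub_zero (S.spField (X s))]
    exact h1
  have hYleaf : S.weights ⬝ᵥ Y 0 = S.weights ⬝ᵥ x₀ := by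
    have h1 : S.weights ⬝ᵥ Y 0 = S.weights ⬝ᵥ X 0 - c * (S.weights ⬝ᵥ S.rot) := by
      simp only [hYdef, dotProduct, mul_sub, Finset.sum_sub_distrib, Finset.mul_sum]
      congr 1
      refine Finset.sum_congr rfl fun k _ => ?_
      ring
    have h2 : c * (S.weights ⬝ᵥ S.rot) = S.weights ⬝ᵥ X 0 - S.weights ⬝ᵥ x₀ := by
      rw [weights_dotProduct_rot, hcdef, div_mul_cancel₀ _ hDs.ne', dotProduct_sub]
    rw [h1, h2]
    ring
  have hY0 : ‖Y 0 - x₀‖ < ρ := by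
    have hc : |c| ≤ K * ‖X 0 - x₀‖ := by
      rw [hcdef, abs_div, abs_of_pos hDs, div_le_iff₀ hDs, hKdef]
      calc |S.weights ⬝ᵥ (X 0 - x₀)| ≤ (∑ k, S.weights k) * ‖X 0 - x₀‖ :=
            abs_weights_dotProduct_le (fun i => (hD i).le) hM _
        _ = (∑ k, S.weights k) / (∑ i, S.D i) * ‖X 0 - x₀‖ * ∑ i, S.D i := by
            field_simp
    have hdecomp : Y 0 - x₀ = (X 0 - x₀) - fun k => c * S.rot k := by
      funext k; simp [hYdef]; ring
    have hrot : ‖fun k : Fin n ⊕ S.Gen => c * S.rot k‖ ≤ |c| := by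
      refine (pi_norm_le_iff_of_nonneg (abs_nonneg c)).2 fun k => ?_
      cases k with
      | inl i => simp [rot]
      | inr g => simp [rot]
    have hX0 : (1 + K) * ‖X 0 - x₀‖ < ρ := by
      have := h0
      rw [lt_div_iff₀ (by positivity)] at this
      linarith
    calc ‖Y 0 - x₀‖ = ‖(X 0 - x₀) - fun k => c * S.rot k‖ := by rw [hdecomp]
      _ ≤ ‖X 0 - x₀‖ + ‖fun k : Fin n ⊕ S.Gen => c * S.rot k‖ := norm_sub_le _ _
      _ ≤ ‖X 0 - x₀‖ + K * ‖X 0 - x₀‖ := by linarith [hrot, hc]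
      _ = (1 + K) * ‖X 0 - x₀‖ := by ring
      _ < ρ := hX0
  have key := H Y T hYsol hYleaf hY0 t ht
  have hshape : ∀ s, Y s - x₀ = X s - fun k => x₀ k + c * S.rot k := fun s => by
    funext k; simp [hYdef]; ring
  rw [hshape t, hshape 0] at key
  exact key

/-- **DCB2013 SI Lemma 1 with Lemma 2 (2) for the structure-preserving (Bergen–Hill) model — the
synchronous equilibrium `(δ⁰, ω_G = 0)` is locally exponentially stable modulo the uniform rotation
of all bus angles.**  `M_i ≥ 0` (generators `M_i > 0`, load buses `M_i = 0`), `D_i > 0`, symmetric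
`b_ij ≥ 0` with a connected coupling graph, an equilibrium `δ⁰` (`Σ_j b_ij sin(δ⁰_i − δ⁰_j) = P⁰_i`)
with `|δ⁰_i − δ⁰_j| < π/2` across every line.  Then there are `ρ, k, λ > 0` such that every solution
`(δ, v)` of the structure-preserving equations (`IsSolutionAt` at every time) with
`‖(δ(0) − δ⁰, v_G(0))‖ < ρ` satisfies, for all `t ≥ 0`,
`‖(δ(t) − (δ⁰ + c𝟙), v_G(t))‖ ≤ k‖(δ(0) − (δ⁰ + c𝟙), v_G(0))‖e^{−λt}`,
`c = (Σ_i D_i(δ_i(0) − δ⁰_i) + Σ_{gen} M_iv_i(0))/Σ_i D_i` (sup norm on `(δ, v_G)`; `v_G` = the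
generator speeds `g ↦ v g`).  MODEL: structure-preserving model, lossless, frequency-dependent loads;
`ρ, k, λ` existential.
[cite: DorflerChertkovBullo2013, SI §3.1 Lemma 1 (ii) with Lemma 2 (2); Padiyar2013, §3.2 eq. (3.2)] -/
theorem syncEquilibrium_locally_expStable (hM : ∀ i, 0 ≤ S.M i) (hD : ∀ i, 0 < S.D i)
    (hb : ∀ i j, S.b i j = S.b j i) (hb0 : ∀ i j, 0 ≤ S.b i j)
    (hconn : ClassicalModel.CouplingConnected S.b) {δ0 : Fin n → ℝ} (hδ0 : S.IsEquilibrium δ0)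
    (harc : ∀ i j, i ≠ j → 0 < S.b i j → |δ0 i - δ0 j| < Real.pi / 2) :
    ∃ ρ > 0, ∃ k > 0, ∃ lam > 0, ∀ δ v : ℝ → Fin n → ℝ, (∀ t, S.IsSolutionAt δ v t) →
      ‖S.phase (δ 0 - δ0) (fun g => v 0 g.1)‖ < ρ →
      ∀ t : ℝ, 0 ≤ t →
        ‖S.phase (fun i => δ t i - (δ0 i
              + (∑ j, S.D j * (δ 0 j - δ0 j) + ∑ g : S.Gen, S.M g.1 * v 0 g.1) / ∑ j, S.D j))
            (fun g => v t g.1)‖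
          ≤ k * ‖S.phase (fun i => δ 0 i - (δ0 i
              + (∑ j, S.D j * (δ 0 j - δ0 j) + ∑ g : S.Gen, S.M g.1 * v 0 g.1) / ∑ j, S.D j))
            (fun g => v 0 g.1)‖ * Real.exp (-lam * t) := by
  obtain ⟨ρ, hρ, k, hk, lam, hlam, H⟩ := expStable_modRotation hM hD hb hb0 hconn hδ0 harc
  refine ⟨ρ, hρ, k, hk, lam, hlam, fun δ v hsol h0 t ht => ?_⟩
  set X : ℝ → Fin n ⊕ S.Gen → ℝ := fun s => S.phase (δ s) (fun g => v s g.1) with hXdef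
  have hXsol : ∀ s ∈ Icc 0 t, HasDerivWithinAt X (S.spField (X s)) (Icc 0 t) s := by
    intro s _
    refine HasDerivAt.hasDerivWithinAt ?_
    rw [hasDerivAt_pi]
    intro k
    cases k with
    | inl i =>
      obtain ⟨a, hδ', hv', hrow⟩ := hsol s i
      by_cases hi : 0 < S.M i
      · have : S.spField (X s) (Sum.inl i) = v s i := by
          simp [hXdef, phase, spField, hi, genSpeed]
        rw [this]
        simpa [hXdef, phase] using hδ'
      · have hM0 : S.M i = 0 := le_antisymm (not_lt.1 hi) (hM i)
        have hvs : v s i = (S.P0 i - S.flow (δ s) i) / S.D i := by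
          rw [hM0, zero_mul, zero_add] at hrow
          field_simp [(hD i).ne']
          linarith
        have : S.spField (X s) (Sum.inl i) = (S.P0 i - S.flow (δ s) i) / S.D i := by
          simp [hXdef, phase, spField, hi]
        rw [this, ← hvs]
        simpa [hXdef, phase] using hδ'
    | inr g =>
      obtain ⟨a, hδ', hv', hrow⟩ := hsol s g.1
      have ha : a = (S.P0 g.1 - S.D g.1 * v s g.1 - S.flow (δ s) g.1) / S.M g.1 := by
        field_simp [g.2.ne']
        linarith
      have : S.spField (X s) (Sum.inr g) = a := by
        rw [ha]; simp [hXdef, phase, spField]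
      rw [this]
      simpa [hXdef, phase] using hv'
  have hdev : X 0 - S.phase δ0 (fun _ => 0) = S.phase (δ 0 - δ0) (fun g => v 0 g.1) := by
    funext k
    cases k with
    | inl i => simp [hXdef, phase]
    | inr g => simp [hXdef, phase]
  have hc : S.weights ⬝ᵥ (X 0 - S.phase δ0 (fun _ => 0))
      = ∑ j, S.D j * (δ 0 j - δ0 j) + ∑ g : S.Gen, S.M g.1 * v 0 g.1 := by
    rw [hdev]
    simp [dotProduct, Fintype.sum_sum_type, weights, phase]
  have key := H X t hXsol (by rw [hdev]; exact h0) t ⟨ht, le_rfl⟩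
  rw [hc] at key
  have hshape : ∀ s, (X s - fun k => S.phase δ0 (fun _ => 0) k
      + (∑ j, S.D j * (δ 0 j - δ0 j) + ∑ g : S.Gen, S.M g.1 * v 0 g.1) / (∑ i, S.D i) * S.rot k)
      = S.phase (fun i => δ s i - (δ0 i
          + (∑ j, S.D j * (δ 0 j - δ0 j) + ∑ g : S.Gen, S.M g.1 * v 0 g.1) / ∑ j, S.D j))
        (fun g => v s g.1) := fun s => by
    funext k
    cases k with
    | inl i => simp [hXdef, phase, rot]
    | inr g => simp [hXdef, phase, rot]
  rw [hshape t, hshape 0] at key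
  exact key

/-! ## §5 An equilibrium with a negative potential-energy curvature is UNSTABLE (mixed
first/second-order pencil `λ²M + λD + L(δ⁰)`, `M_i ≥ 0`, `D_i > 0`) (append 2026-08-27, g9)

The unstable direction of Chiang's type correspondence, read on the structure-preserving model: a
direction `e` of negative curvature of the potential energy at an equilibrium `δᵘ`,
`Σ_i e_i Σ_j b_ij cos(δᵘ_i − δᵘ_j)(e_i − e_j) < 0`, gives (linear Kelvin–Tait–Chetaev mechanism,
`Literature.Analysis.ODE.exists_pos_pencil_kernel_diagonal` with `M_i ≥ 0`, `M_i + D_i > 0`) a real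
`λ > 0` and a real `v ≠ 0` with `L(δᵘ)v + λDv + λ²Mv = 0`, hence the real eigenvector `(v, λv_G)` of
the Jacobian with eigenvalue `λ`; the general instability half of Lyapunov's indirect method
(`Literature.Analysis.ODE.unstable_of_matrix_real_eig_pos`) concludes.
[cite: Chiang1995, §6.3 Theorem 6.1 (direction type ≥ 1 ⇒ unstable); DorflerChertkovBullo2013,
SI §3.1 Lemma 1 (mixed first/second-order model)] -/

/-- **Negative curvature ⇒ a positive real eigenvalue of the structure-preserving Jacobian.**
`M_i ≥ 0`, `D_i > 0`, symmetric `b`, and `Σ_i e_i Σ_j b_ij cos(δᵘ_i − δᵘ_j)(e_i − e_j) < 0` ⇒ the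
Jacobian at `δᵘ` has a real eigenvalue `λ > 0` with a real eigenvector.
[cite: Chiang1995, §6.3 Theorem 6.1 (direction type ≥ 1 ⇒ unstable); DorflerChertkovBullo2013, SI §3.1 Lemma 1] -/
theorem exists_spJac_real_eig_pos (hM : ∀ i, 0 ≤ S.M i) (hD : ∀ i, 0 < S.D i)
    (hb : ∀ i j, S.b i j = S.b j i) {δu : Fin n → ℝ} {e : Fin n → ℝ}
    (hneg : ∑ i, e i * ∑ j, S.toDroopNetwork.linWeight δu i j * (e i - e j) < 0) :
    ∃ lam : ℝ, 0 < lam ∧ ∃ x : Fin n ⊕ S.Gen → ℝ, x ≠ 0 ∧ S.spJac δu *ᵥ x = lam • x := by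
  have hY : ∀ i j, S.toDroopNetwork.Yabs i j = S.toDroopNetwork.Yabs j i := fun i j => hb i j
  have hlap : ∀ (u : Fin n → ℝ) i, (S.toDroopNetwork.lap δu *ᵥ u) i
      = ∑ j, S.toDroopNetwork.linWeight δu i j * (u i - u j) :=
    fun u i => DroopNetwork.lap_mulVec (N := S.toDroopNetwork) δu u i
  have he : e ⬝ᵥ (S.toDroopNetwork.lap δu *ᵥ e) < 0 := by
    simp only [dotProduct, hlap]
    exact hneg
  obtain ⟨lam, hlam, v, hv0, hv⟩ := Literature.Analysis.ODE.exists_pos_pencil_kernel_diagonal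
    hM (fun i => (hD i).le) (fun i => by linarith [hM i, hD i])
    (DroopNetwork.lap_symm (N := S.toDroopNetwork) hY δu) he
  refine ⟨lam, hlam, Sum.elim v (fun g => lam * v g.1), ?_, ?_⟩
  · intro h
    apply hv0
    funext i
    have := congrFun h (Sum.inl i)
    simpa using this
  · funext k
    cases k with
    | inl i =>
      by_cases hi : 0 < S.M i
      · rw [spJac_mulVec_inl_gen δu _ hi]
        simp
      · rw [spJac_mulVec_inl_load δu _ hi]
        simp only [Sum.elim_inl, Pi.smul_apply, smul_eq_mul]
        have hM0 : S.M i = 0 := le_antisymm (not_lt.1 hi) (hM i)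
        have h1 := hv i
        rw [hM0, hlap] at h1
        rw [div_eq_iff (hD i).ne']
        linear_combination (-1 : ℝ) * h1
    | inr g =>
      rw [spJac_mulVec_inr]
      simp only [Sum.elim_inl, Sum.elim_inr, Pi.smul_apply, smul_eq_mul]
      have h1 := hv g.1
      rw [hlap] at h1
      rw [div_eq_iff g.2.ne']
      linear_combination (-1 : ℝ) * h1

/-- **An equilibrium of the structure-preserving model with a negative potential-energy curvature is
UNSTABLE** (state-space form).  `M_i ≥ 0`, `D_i > 0`, symmetric `b`, an equilibrium angle vector
`δᵘ` (`IsEquilibrium`) and a direction `e` with `Σ_i e_i Σ_j b_ij cos(δᵘ_i − δᵘ_j)(e_i − e_j) < 0`.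
Then there is `ε > 0` such that for every `η > 0` some state `x₁` with `‖x₁ − (δᵘ, 0)‖ < η` admits no
solution of `X' = spField X` on `[0, ∞)` staying `ε`-close to `(δᵘ, 0)`.  MODEL: structure-preserving
model (Bergen–Hill), lossless, frequency-dependent loads; `ε` existential.
[cite: Chiang1995, §6.3 Theorem 6.1 (direction type ≥ 1 ⇒ unstable); Khalil2002, Theorem 4.7 (part 2)] -/
theorem unstable_of_negativeCurvature (hM : ∀ i, 0 ≤ S.M i) (hD : ∀ i, 0 < S.D i)
    (hb : ∀ i j, S.b i j = S.b j i) {δu : Fin n → ℝ} (hδu : S.IsEquilibrium δu) {e : Fin n → ℝ}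
    (hneg : ∑ i, e i * ∑ j, S.toDroopNetwork.linWeight δu i j * (e i - e j) < 0) :
    ∃ ε > 0, ∀ η > 0, ∃ x₁ : Fin n ⊕ S.Gen → ℝ, ‖x₁ - S.phase δu (fun _ => 0)‖ < η ∧
      ∀ X : ℝ → Fin n ⊕ S.Gen → ℝ,
        (∀ T : ℝ, ∀ t ∈ Icc 0 T, HasDerivWithinAt X (S.spField (X t)) (Icc 0 T) t) → X 0 = x₁ →
        ∃ t : ℝ, 0 ≤ t ∧ ε < ‖X t - S.phase δu (fun _ => 0)‖ := by
  obtain ⟨lam, hlam, x, hx0, hJx⟩ := exists_spJac_real_eig_pos hM hD hb hneg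
  exact Literature.Analysis.ODE.unstable_of_matrix_real_eig_pos (hasFDerivAt_spField δu fun _ => 0)
    (spField_equilibrium hδu) hx0 hJx hlam

/-- **The same in the tree's solution notion** (`IsSolutionAt δ v t` at every time): for every
`η > 0` some initial data `(δ₁, w₁)` (bus angles, generator speeds) with `‖(δ₁ − δᵘ, w₁)‖ < η` has NO
solution staying `ε`-close: every solution with `δ(0) = δ₁`, `v_G(0) = w₁` reaches
`‖(δ(t) − δᵘ, v_G(t))‖ > ε` at some `t ≥ 0`.
[cite: Chiang1995, §6.3 Theorem 6.1 (direction type ≥ 1 ⇒ unstable); Padiyar2013, §3.2 eq. (3.2)] -/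
theorem syncEquilibrium_unstable_of_negativeCurvature (hM : ∀ i, 0 ≤ S.M i) (hD : ∀ i, 0 < S.D i)
    (hb : ∀ i j, S.b i j = S.b j i) {δu : Fin n → ℝ} (hδu : S.IsEquilibrium δu) {e : Fin n → ℝ}
    (hneg : ∑ i, e i * ∑ j, S.toDroopNetwork.linWeight δu i j * (e i - e j) < 0) :
    ∃ ε > 0, ∀ η > 0, ∃ δ₁ : Fin n → ℝ, ∃ w₁ : S.Gen → ℝ,
      ‖S.phase (δ₁ - δu) w₁‖ < η ∧
      ∀ δ v : ℝ → Fin n → ℝ, (∀ t, S.IsSolutionAt δ v t) → δ 0 = δ₁ → (fun g : S.Gen => v 0 g.1) = w₁ →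
        ∃ t : ℝ, 0 ≤ t ∧ ε < ‖S.phase (fun i => δ t i - δu i) (fun g => v t g.1)‖ := by
  obtain ⟨ε, hε, H⟩ := unstable_of_negativeCurvature hM hD hb hδu hneg
  refine ⟨ε, hε, fun η hη => ?_⟩
  obtain ⟨x₁, hx₁, Hx⟩ := H η hη
  refine ⟨fun i => x₁ (Sum.inl i), fun g => x₁ (Sum.inr g), ?_, fun δ v hsol hδ0 hv0 => ?_⟩
  · have : S.phase ((fun i => x₁ (Sum.inl i)) - δu) (fun g => x₁ (Sum.inr g))
        = x₁ - S.phase δu (fun _ => 0) := by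
      funext k
      cases k with
      | inl i => simp [phase]
      | inr g => simp [phase]
    rw [this]; exact hx₁
  · set X : ℝ → Fin n ⊕ S.Gen → ℝ := fun s => S.phase (δ s) (fun g => v s g.1) with hXdef
    have hXsol : ∀ T : ℝ, ∀ s ∈ Icc 0 T, HasDerivWithinAt X (S.spField (X s)) (Icc 0 T) s := by
      intro T s _
      refine HasDerivAt.hasDerivWithinAt ?_
      rw [hasDerivAt_pi]
      intro k
      cases k with
      | inl i =>
        obtain ⟨a, hδ', hv', hrow⟩ := hsol s i
        by_cases hi : 0 < S.M i
        · have : S.spField (X s) (Sum.inl i) = v s i := by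
            simp [hXdef, phase, spField, hi, genSpeed]
          rw [this]
          simpa [hXdef, phase] using hδ'
        · have hM0 : S.M i = 0 := le_antisymm (not_lt.1 hi) (hM i)
          have hvs : v s i = (S.P0 i - S.flow (δ s) i) / S.D i := by
            rw [hM0, zero_mul, zero_add] at hrow
            field_simp [(hD i).ne']
            linarith
          have : S.spField (X s) (Sum.inl i) = (S.P0 i - S.flow (δ s) i) / S.D i := by
            simp [hXdef, phase, spField, hi]
          rw [this, ← hvs]
          simpa [hXdef, phase] using hδ'
      | inr g =>
        obtain ⟨a, hδ', hv', hrow⟩ := hsol s g.1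
        have ha : a = (S.P0 g.1 - S.D g.1 * v s g.1 - S.flow (δ s) g.1) / S.M g.1 := by
          field_simp [g.2.ne']
          linarith
        have : S.spField (X s) (Sum.inr g) = a := by
          rw [ha]; simp [hXdef, phase, spField]
        rw [this]
        simpa [hXdef, phase] using hv'
    have hX0 : X 0 = x₁ := by
      funext k
      cases k with
      | inl i => simp [hXdef, phase, hδ0]
      | inr g =>
        have hvg : v 0 g.1 = x₁ (Sum.inr g) := by simpa using congrFun hv0 g
        simp [hXdef, phase, hvg]
    obtain ⟨t, ht, hfar⟩ := Hx X hXsol hX0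
    refine ⟨t, ht, ?_⟩
    have : X t - S.phase δu (fun _ => 0) = S.phase (fun i => δ t i - δu i) (fun g => v t g.1) := by
      funext k
      cases k with
      | inl i => simp [hXdef, phase]
      | inr g => simp [hXdef, phase]
    rw [← this]; exact hfar

/-! ## §6 A transversal strict local minimum of the potential energy is locally exponentially
stable — the stable clause of Manik–Timme–Witthaut's Lemma 1 («power grid model») in certificate
form for the structure-preserving model, equilibria OUTSIDE the arc included (append 2026-08-27, g9)

§3–§4 derive `L(δ⁰) ⪰ 0` with kernel `span 𝟙` from the ARC condition (`b ≥ 0`, connected,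
`|δ⁰_i − δ⁰_j| < π/2`).  The mixed-order spectral argument needs only the conclusion, on the REAL
form: `u ↦ Σ_i u_i Σ_j b_ij cos(δ⁰_i − δ⁰_j)(u_i − u_j) ≥ 0` with equality only for constant `u`,
which an exact PSD + rank certificate delivers also for loop-flow equilibria with a line loaded
beyond `π/2`; §5 is the converse direction (one negative direction ⇒ unstable).
[cite: ManikTimmeWitthaut2017, §2 Lemma 1 (arXiv:1611.09825 p0004 L46–L55: «… a local minimum of
the potential … if and only if it is transversally asymptotically stable for both Kuramoto system
and the power grid model system»); DorflerChertkovBullo2013, SI §3.1 Lemma 1 with Lemma 2 (2)] -/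

/-- **The mixed-order spectral lemma from the REAL Hessian form** (`M_i ≥ 0`, `D_i > 0`): symmetric
`c`, real form `≥ 0` with kernel the constants: if `v ≠ 0` and
`μ²M_iv_i + μD_iv_i + Σ_j c_ij(v_i − v_j) = 0` for every `i`, then `Re μ < 0`, or `μ = 0` and `v`
is constant. [folklore] -/
private theorem mixedOrder_eig_of_psd {c : Fin n → Fin n → ℝ} {D M : Fin n → ℝ}
    (hc : ∀ i j, c i j = c j i)
    (hpsd : ∀ u : Fin n → ℝ, 0 ≤ ∑ i, u i * ∑ j, c i j * (u i - u j))
    (hker : ∀ u : Fin n → ℝ, ∑ i, u i * ∑ j, c i j * (u i - u j) = 0 → ∃ a : ℝ, u = fun _ => a)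
    (hD : ∀ i, 0 < D i) (hM : ∀ i, 0 ≤ M i)
    {μ : ℂ} {v : Fin n → ℂ} (hv : v ≠ 0)
    (hrow : ∀ i, -(∑ j, (c i j : ℂ) * (v i - v j)) = μ * (D i : ℂ) * v i + μ ^ 2 * (M i : ℂ) * v i) :
    μ.re < 0 ∨ (μ = 0 ∧ ∃ a : ℂ, v = fun _ => a) := by
  obtain ⟨R, hR⟩ : ∃ R : ℂ, R = ∑ i, conj (v i) * ∑ j, (c i j : ℂ) * (v i - v j) := ⟨_, rfl⟩
  obtain ⟨Q, hQ⟩ : ∃ Q : ℝ, Q = ∑ i, ∑ j, c i j * ‖v i - v j‖ ^ 2 := ⟨_, rfl⟩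
  obtain ⟨Nd, hNd⟩ : ∃ Nd : ℝ, Nd = ∑ i, D i * ‖v i‖ ^ 2 := ⟨_, rfl⟩
  obtain ⟨Nm, hNm⟩ : ∃ Nm : ℝ, Nm = ∑ i, M i * ‖v i‖ ^ 2 := ⟨_, rfl⟩
  obtain ⟨fr, hfr⟩ : ∃ fr : ℝ, fr = ∑ i, (v i).re * ∑ j, c i j * ((v i).re - (v j).re) := ⟨_, rfl⟩
  obtain ⟨fi, hfi⟩ : ∃ fi : ℝ, fi = ∑ i, (v i).im * ∑ j, c i j * ((v i).im - (v j).im) := ⟨_, rfl⟩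
  have hRQ : 2 * R = (Q : ℂ) := by rw [hR, hQ]; exact conj_lap_form' hc v
  have hRre : R.re = fr + fi := by rw [hR, hfr, hfi]; exact DroopNetwork.re_conj_lapForm c v
  have hQeq : Q = 2 * (fr + fi) := by
    have h := congrArg Complex.re hRQ
    simp only [Complex.mul_re, Complex.ofReal_re, hRre] at h
    norm_num at h
    linarith
  have hfr0 : 0 ≤ fr := by rw [hfr]; exact hpsd _
  have hfi0 : 0 ≤ fi := by rw [hfi]; exact hpsd _
  have hQ0 : 0 ≤ Q := by rw [hQeq]; positivity
  have hNm0 : 0 ≤ Nm := by rw [hNm]; exact Finset.sum_nonneg fun i _ => mul_nonneg (hM i) (sq_nonneg _)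
  obtain ⟨i0, hi0⟩ : ∃ i, v i ≠ 0 := by
    by_contra hcon
    push Not at hcon
    exact hv (funext hcon)
  have hNd0 : 0 < Nd := by
    have hterm : ∀ j ∈ (Finset.univ : Finset (Fin n)), 0 ≤ D j * ‖v j‖ ^ 2 :=
      fun j _ => mul_nonneg (hD j).le (sq_nonneg _)
    rw [hNd]
    exact lt_of_lt_of_le (mul_pos (hD i0) (by positivity))
      (Finset.single_le_sum hterm (Finset.mem_univ i0))
  have hsum : -R = μ * (Nd : ℂ) + μ ^ 2 * (Nm : ℂ) := by
    have e1 : ∑ i, conj (v i) * -(∑ j, (c i j : ℂ) * (v i - v j))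
        = ∑ i, conj (v i) * (μ * (D i : ℂ) * v i + μ ^ 2 * (M i : ℂ) * v i) :=
      Finset.sum_congr rfl fun i _ => by rw [hrow i]
    have e2 : ∑ i, conj (v i) * (μ * (D i : ℂ) * v i + μ ^ 2 * (M i : ℂ) * v i)
        = μ * (Nd : ℂ) + μ ^ 2 * (Nm : ℂ) := by
      rw [hNd, hNm]
      push_cast
      rw [Finset.mul_sum, Finset.mul_sum, ← Finset.sum_add_distrib]
      refine Finset.sum_congr rfl fun i _ => ?_
      rw [← Complex.conj_mul' (v i)]
      ring
    rw [← e2, ← e1, hR]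
    simp [Finset.sum_neg_distrib, mul_neg]
  have hkey : μ ^ 2 * (Nm : ℂ) + μ * (Nd : ℂ) + (Q : ℂ) / 2 = 0 := by
    linear_combination (-1 : ℂ) * hsum - (1 / 2 : ℂ) * hRQ
  -- real and imaginary parts of the quadratic relation
  have hre : (μ.re * μ.re - μ.im * μ.im) * Nm + μ.re * Nd + Q / 2 = 0 := by
    have := congrArg Complex.re hkey
    simp [pow_two, Complex.mul_re] at this
    linarith
  have him : (2 * μ.re * μ.im) * Nm + μ.im * Nd = 0 := by
    have := congrArg Complex.im hkey
    simp [pow_two, Complex.mul_im, Complex.mul_re] at this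
    linarith
  -- the constancy argument when `Q = 0`: both real forms vanish
  have hconst : Q = 0 → ∃ a : ℂ, v = fun _ => a := by
    intro hQzero
    have hfr00 : fr = 0 := by linarith
    have hfi00 : fi = 0 := by linarith
    obtain ⟨ar, har⟩ := hker _ (hfr ▸ hfr00)
    obtain ⟨ai, hai⟩ := hker _ (hfi ▸ hfi00)
    refine ⟨⟨ar, ai⟩, funext fun i => Complex.ext ?_ ?_⟩
    · simpa using congrFun har i
    · simpa using congrFun hai i
  -- case analysis on the imaginary part: `μ.im (2 μ.re Nm + Nd) = 0`
  have him' : μ.im * (2 * μ.re * Nm + Nd) = 0 := by linarith [him]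
  rcases mul_eq_zero.1 him' with him0 | hfac
  · have hre' : μ.re * μ.re * Nm + μ.re * Nd + Q / 2 = 0 := by rw [him0] at hre; linarith
    by_cases ha : μ.re < 0
    · exact Or.inl ha
    · push Not at ha
      have h1 : 0 ≤ μ.re * μ.re * Nm := by positivity
      have h2 : 0 ≤ μ.re * Nd := by positivity
      have hQz : Q = 0 := by linarith
      have hare : μ.re = 0 := by nlinarith
      right
      refine ⟨Complex.ext (by simpa using hare) (by simpa using him0), hconst hQz⟩
  · left
    nlinarith

/-- **The spectral sentence from a transversal strict local minimum** (structure-preserving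
linearisation): `M_i ≥ 0`, `D_i > 0`, symmetric `b`, and at `δ⁰` the real Hessian form
`u ↦ Σ_i u_i Σ_j b_ij cos(δ⁰_i − δ⁰_j)(u_i − u_j)` is `≥ 0` with kernel the constants (no arc, no sign
condition on `b`).  Then every complex eigenpair `(μ, v)` of `spJac δ⁰` has `Re μ < 0`, or `μ = 0`
with `v` a complex multiple of the rotation mode `(𝟙, 0)`.
[cite: ManikTimmeWitthaut2017, §2 Lemma 1 (stable clause, «power grid model»); DorflerChertkovBullo2013, SI §3.1 Lemma 1] -/
theorem spJac_eig_re_neg_or_rotation_of_posCurvature (hM : ∀ i, 0 ≤ S.M i) (hD : ∀ i, 0 < S.D i)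
    (hb : ∀ i j, S.b i j = S.b j i) {δs : Fin n → ℝ}
    (hpsd : ∀ u : Fin n → ℝ, 0 ≤ ∑ i, u i * ∑ j, S.toDroopNetwork.linWeight δs i j * (u i - u j))
    (hker : ∀ u : Fin n → ℝ, ∑ i, u i * ∑ j, S.toDroopNetwork.linWeight δs i j * (u i - u j) = 0 →
      ∃ a : ℝ, u = fun _ => a)
    {μ : ℂ} {v : Fin n ⊕ S.Gen → ℂ} (hv : v ≠ 0)
    (hJ : (S.spJac δs).map ((↑) : ℝ → ℂ) *ᵥ v = μ • v) :
    μ.re < 0 ∨ (μ = 0 ∧ ∃ a : ℂ, v = fun k => a * (S.rot k : ℂ)) := by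
  set c : Fin n → Fin n → ℝ := S.toDroopNetwork.linWeight δs with hcdef
  have hc : ∀ i j, c i j = c j i := DroopNetwork.linWeight_symm (N := S.toDroopNetwork) hb δs
  -- the `δ`-part of the eigenvector and the row relations
  set v₁ : Fin n → ℂ := fun i => v (Sum.inl i) with hv₁
  have hgenrow : ∀ g : S.Gen, v (Sum.inr g) = μ * v₁ g.1 := by
    intro g
    have := congrFun hJ (Sum.inl g.1)
    rw [spJac_map_mulVec_inl_gen δs v g.2] at this
    simpa using this
  have hrow : ∀ i, -(∑ j, (c i j : ℂ) * (v₁ i - v₁ j))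
      = μ * (S.D i : ℂ) * v₁ i + μ ^ 2 * (S.M i : ℂ) * v₁ i := by
    intro i
    by_cases hi : 0 < S.M i
    · have h2 := congrFun hJ (Sum.inr ⟨i, hi⟩)
      rw [spJac_map_mulVec_inr] at h2
      have hMi : (S.M i : ℂ) ≠ 0 := by exact_mod_cast hi.ne'
      simp only [Pi.smul_apply, smul_eq_mul] at h2
      rw [div_eq_iff hMi, hgenrow ⟨i, hi⟩] at h2
      simp only [hcdef, hv₁]
      linear_combination h2
    · have h2 := congrFun hJ (Sum.inl i)
      rw [spJac_map_mulVec_inl_load δs v hi] at h2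
      have hDi : (S.D i : ℂ) ≠ 0 := by exact_mod_cast (hD i).ne'
      simp only [Pi.smul_apply, smul_eq_mul] at h2
      rw [div_eq_iff hDi] at h2
      have hM0 : S.M i = 0 := le_antisymm (not_lt.1 hi) (hM i)
      simp only [hcdef, hv₁, hM0, Complex.ofReal_zero, mul_zero, zero_mul, add_zero]
      linear_combination h2
  have hv₁0 : v₁ ≠ 0 := by
    intro h0
    apply hv
    funext k
    cases k with
    | inl i => exact congrFun h0 i
    | inr g => rw [hgenrow g, h0]; simp
  rcases mixedOrder_eig_of_psd hc hpsd hker hD hM hv₁0 hrow with hre | ⟨hμ0, a, ha⟩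
  · exact Or.inl hre
  · refine Or.inr ⟨hμ0, a, funext fun k => ?_⟩
    cases k with
    | inl i => simpa [rot] using congrFun ha i
    | inr g => simp [rot, hgenrow g, hμ0]

/-- **The arc condition is one such certificate** for the structure-preserving data: `b ≥ 0` with a
connected coupling graph and `|δ⁰_i − δ⁰_j| < π/2` across every line give the real Hessian form
`≥ 0` with kernel the constants (§4's hypotheses are a special case of §6's).
[cite: DorflerChertkovBullo2013, SI §3.1 proof of Lemma 2 (2) («L(θ*) … positive semidefinite
Laplacian … simple zero eigenvalue»)] -/
theorem posCurvature_of_arc (hb : ∀ i j, S.b i j = S.b j i) (hb0 : ∀ i j, 0 ≤ S.b i j)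
    (hconn : ClassicalModel.CouplingConnected S.b) {δs : Fin n → ℝ}
    (harc : ∀ i j, i ≠ j → 0 < S.b i j → |δs i - δs j| < Real.pi / 2) :
    (∀ u : Fin n → ℝ, 0 ≤ ∑ i, u i * ∑ j, S.toDroopNetwork.linWeight δs i j * (u i - u j)) ∧
    (∀ u : Fin n → ℝ, ∑ i, u i * ∑ j, S.toDroopNetwork.linWeight δs i j * (u i - u j) = 0 →
      ∃ a : ℝ, u = fun _ => a) := by
  have ha : ∀ i j, 0 ≤ S.toDroopNetwork.a i j := fun i j => by rw [toDroopNetwork_a]; exact hb0 i j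
  have hconn' : ClassicalModel.CouplingConnected S.toDroopNetwork.a := by
    rw [toDroopNetwork_a]; exact hconn
  have harc' : ∀ i j, i ≠ j → 0 < S.toDroopNetwork.a i j → |δs i - δs j| < Real.pi / 2 :=
    fun i j hij hpos => harc i j hij (by rw [toDroopNetwork_a] at hpos; exact hpos)
  exact DroopNetwork.posCurvature_of_arc (N := S.toDroopNetwork) ha hconn' (fun i j => hb i j) harc'

/-- **MTW2017 Lemma 1, stable clause, structure-preserving model — LES within a leaf of the
conserved quantity from a PSD + kernel certificate.**  `M_i ≥ 0`, `D_i > 0`, symmetric `b`, an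
equilibrium `δ⁰` (in the arc or not) whose real Hessian form is `≥ 0` with kernel the constants.
[cite: ManikTimmeWitthaut2017, §2 Lemma 1 (stable direction, «power grid model»);
DorflerChertkovBullo2013, SI §3.1 Lemmas 1–2] -/
theorem expStable_within_leaf_of_posCurvature (hM : ∀ i, 0 ≤ S.M i) (hD : ∀ i, 0 < S.D i)
    (hb : ∀ i j, S.b i j = S.b j i) {δ0 : Fin n → ℝ} (hδ0 : S.IsEquilibrium δ0)
    (hpsd : ∀ u : Fin n → ℝ, 0 ≤ ∑ i, u i * ∑ j, S.toDroopNetwork.linWeight δ0 i j * (u i - u j))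
    (hker : ∀ u : Fin n → ℝ, ∑ i, u i * ∑ j, S.toDroopNetwork.linWeight δ0 i j * (u i - u j) = 0 →
      ∃ a : ℝ, u = fun _ => a) :
    ∃ ρ > 0, ∃ k > 0, ∃ lam > 0, ∀ (X : ℝ → Fin n ⊕ S.Gen → ℝ) (T : ℝ),
      (∀ t ∈ Icc 0 T, HasDerivWithinAt X (S.spField (X t)) (Icc 0 T) t) →
      S.weights ⬝ᵥ X 0 = S.weights ⬝ᵥ S.phase δ0 (fun _ => 0) →
      ‖X 0 - S.phase δ0 (fun _ => 0)‖ < ρ →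
      ∀ t ∈ Icc 0 T, ‖X t - S.phase δ0 (fun _ => 0)‖
        ≤ k * ‖X 0 - S.phase δ0 (fun _ => 0)‖ * Real.exp (-lam * t) := by
  rcases isEmpty_or_nonempty (Fin n) with hn | hn
  · refine ⟨1, one_pos, 1, one_pos, 1, one_pos, fun X T _ _ _ t _ => ?_⟩
    have : X t - S.phase δ0 (fun _ => 0) = 0 := funext fun k => by
      cases k with
      | inl i => exact (IsEmpty.false i).elim
      | inr g => exact (IsEmpty.false g.1).elim
    rw [this, norm_zero]
    positivity
  have hDs : 0 < ∑ i, S.D i := Finset.sum_pos (fun i _ => hD i) Finset.univ_nonempty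
  have hlr : S.weights ⬝ᵥ S.rot ≠ 0 := by rw [weights_dotProduct_rot]; exact hDs.ne'
  have hbal := S.sum_P0_eq_zero_of_isEquilibrium hb hδ0
  exact Literature.Analysis.ODE.exists_expStable_within_of_eig_re_neg_or_smul
    (hasFDerivAt_spField δ0 fun _ => 0) (spField_equilibrium hδ0)
    (fun x => weights_dotProduct_spField (fun i => (hD i).ne') hb hbal x) hlr
    (fun μ v hv hJ => spJac_eig_re_neg_or_rotation_of_posCurvature hM hD hb hpsd hker hv hJ)

/-- **From the leaf to every nearby state (the conserved quantity picks the rotation)** — the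
bookkeeping of `expStable_modRotation` with the within-leaf estimate taken as a hypothesis `H`:
`M_i ≥ 0`, `D_i > 0`; every solution of `X' = spField X` on `[0, T]` with
`‖X(0) − (δ⁰, 0)‖ < ρ/(1 + K)`, `K = Σ weights/Σ D`, satisfies
`‖X(t) − (δ⁰ + c𝟙, 0)‖ ≤ k‖X(0) − (δ⁰ + c𝟙, 0)‖e^{−λt}`, `c = weights·(X(0) − (δ⁰, 0))/Σ_i D_i`.
[cite: DorflerChertkovBullo2013, SI §3.1 Lemma 1 (ii) with Lemma 2 (2)] -/
theorem expStable_modRotation_of_within_leaf (hM : ∀ i, 0 ≤ S.M i) (hD : ∀ i, 0 < S.D i)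
    {δ0 : Fin n → ℝ} {ρ k lam : ℝ}
    (H : ∀ (X : ℝ → Fin n ⊕ S.Gen → ℝ) (T : ℝ),
      (∀ t ∈ Icc 0 T, HasDerivWithinAt X (S.spField (X t)) (Icc 0 T) t) →
      S.weights ⬝ᵥ X 0 = S.weights ⬝ᵥ S.phase δ0 (fun _ => 0) →
      ‖X 0 - S.phase δ0 (fun _ => 0)‖ < ρ →
      ∀ t ∈ Icc 0 T, ‖X t - S.phase δ0 (fun _ => 0)‖
        ≤ k * ‖X 0 - S.phase δ0 (fun _ => 0)‖ * Real.exp (-lam * t)) :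
    ∀ (X : ℝ → Fin n ⊕ S.Gen → ℝ) (T : ℝ),
      (∀ t ∈ Icc 0 T, HasDerivWithinAt X (S.spField (X t)) (Icc 0 T) t) →
      ‖X 0 - S.phase δ0 (fun _ => 0)‖ < ρ / (1 + (∑ k, S.weights k) / ∑ i, S.D i) →
      ∀ t ∈ Icc 0 T,
        ‖X t - fun k => S.phase δ0 (fun _ => 0) k
            + S.weights ⬝ᵥ (X 0 - S.phase δ0 (fun _ => 0)) / (∑ i, S.D i) * S.rot k‖
          ≤ k * ‖X 0 - fun k => S.phase δ0 (fun _ => 0) k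
              + S.weights ⬝ᵥ (X 0 - S.phase δ0 (fun _ => 0)) / (∑ i, S.D i) * S.rot k‖
            * Real.exp (-lam * t) := by
  intro X T hX h0 t ht
  rcases isEmpty_or_nonempty (Fin n) with hn | hn
  · have hz : ∀ s, (X s - fun k => S.phase δ0 (fun _ => 0) k
        + S.weights ⬝ᵥ (X 0 - S.phase δ0 (fun _ => 0)) / (∑ i, S.D i) * S.rot k) = 0 :=
      fun s => funext fun k => by
        cases k with
        | inl i => exact (IsEmpty.false i).elim
        | inr g => exact (IsEmpty.false g.1).elim
    have hz' : ∀ s, X s - S.phase δ0 (fun _ => 0) = 0 := fun s => funext fun k => by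
      cases k with
      | inl i => exact (IsEmpty.false i).elim
      | inr g => exact (IsEmpty.false g.1).elim
    have hleaf : S.weights ⬝ᵥ X 0 = S.weights ⬝ᵥ S.phase δ0 (fun _ => 0) := by
      simp [dotProduct]
    have hρ : ‖X 0 - S.phase δ0 (fun _ => 0)‖ < ρ := by
      have hw0 : (∑ k, S.weights k) / ∑ i, S.D i = 0 := by simp
      rw [hw0, add_zero, div_one] at h0
      exact h0
    have key := H X T hX hleaf hρ t ht
    rw [hz' t, hz' 0] at key
    rw [hz t, hz 0]
    exact key
  have hDs : 0 < ∑ i, S.D i := Finset.sum_pos (fun i _ => hD i) Finset.univ_nonempty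
  obtain ⟨K, hKdef⟩ : ∃ K : ℝ, K = (∑ k, S.weights k) / ∑ i, S.D i := ⟨_, rfl⟩
  have hK0 : 0 ≤ K := hKdef ▸ div_nonneg (Finset.sum_nonneg fun k _ => by
    cases k with
    | inl i => exact (hD i).le
    | inr g => exact hM g.1) hDs.le
  rw [← hKdef] at h0
  set x₀ : Fin n ⊕ S.Gen → ℝ := S.phase δ0 (fun _ => 0) with hx₀
  set c : ℝ := S.weights ⬝ᵥ (X 0 - x₀) / ∑ i, S.D i with hcdef
  set Y : ℝ → Fin n ⊕ S.Gen → ℝ := fun s k => X s k - c * S.rot k with hYdef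
  have hYsol : ∀ s ∈ Icc 0 T, HasDerivWithinAt Y (S.spField (Y s)) (Icc 0 T) s := by
    intro s hs
    have h1 : HasDerivWithinAt Y (S.spField (X s) - 0) (Icc 0 T) s :=
      (hX s hs).sub (hasDerivWithinAt_const s (Icc 0 T) (fun k : Fin n ⊕ S.Gen => c * S.rot k))
    have h2 : S.spField (Y s) = S.spField (X s) := by
      have := spField_add_rot (S := S) (X s) (-c)
      simpa [hYdef, sub_eq_add_neg, neg_mul] using this
    rw [h2, ← sub_zero (S.spField (X s))]
    exact h1
  have hYleaf : S.weights ⬝ᵥ Y 0 = S.weights ⬝ᵥ x₀ := by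
    have h1 : S.weights ⬝ᵥ Y 0 = S.weights ⬝ᵥ X 0 - c * (S.weights ⬝ᵥ S.rot) := by
      simp only [hYdef, dotProduct, mul_sub, Finset.sum_sub_distrib, Finset.mul_sum]
      congr 1
      refine Finset.sum_congr rfl fun k _ => ?_
      ring
    have h2 : c * (S.weights ⬝ᵥ S.rot) = S.weights ⬝ᵥ X 0 - S.weights ⬝ᵥ x₀ := by
      rw [weights_dotProduct_rot, hcdef, div_mul_cancel₀ _ hDs.ne', dotProduct_sub]
    rw [h1, h2]
    ring
  have hY0 : ‖Y 0 - x₀‖ < ρ := by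
    have hc : |c| ≤ K * ‖X 0 - x₀‖ := by
      rw [hcdef, abs_div, abs_of_pos hDs, div_le_iff₀ hDs, hKdef]
      calc |S.weights ⬝ᵥ (X 0 - x₀)| ≤ (∑ k, S.weights k) * ‖X 0 - x₀‖ :=
            abs_weights_dotProduct_le (fun i => (hD i).le) hM _
        _ = (∑ k, S.weights k) / (∑ i, S.D i) * ‖X 0 - x₀‖ * ∑ i, S.D i := by
            field_simp
    have hdecomp : Y 0 - x₀ = (X 0 - x₀) - fun k => c * S.rot k := by
      funext k; simp [hYdef]; ring
    have hrot : ‖fun k : Fin n ⊕ S.Gen => c * S.rot k‖ ≤ |c| := by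
      refine (pi_norm_le_iff_of_nonneg (abs_nonneg c)).2 fun k => ?_
      cases k with
      | inl i => simp [rot]
      | inr g => simp [rot]
    have hX0 : (1 + K) * ‖X 0 - x₀‖ < ρ := by
      have := h0
      rw [lt_div_iff₀ (by positivity)] at this
      linarith
    calc ‖Y 0 - x₀‖ = ‖(X 0 - x₀) - fun k => c * S.rot k‖ := by rw [hdecomp]
      _ ≤ ‖X 0 - x₀‖ + ‖fun k : Fin n ⊕ S.Gen => c * S.rot k‖ := norm_sub_le _ _
      _ ≤ ‖X 0 - x₀‖ + K * ‖X 0 - x₀‖ := by linarith [hrot, hc]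
      _ = (1 + K) * ‖X 0 - x₀‖ := by ring
      _ < ρ := hX0
  have key := H Y T hYsol hYleaf hY0 t ht
  have hshape : ∀ s, Y s - x₀ = X s - fun k => x₀ k + c * S.rot k := fun s => by
    funext k; simp [hYdef]; ring
  rw [hshape t, hshape 0] at key
  exact key

/-- **MTW2017 Lemma 1, stable clause, structure-preserving model, modulo the rotation (state-space
form).**  `M_i ≥ 0`, `D_i > 0`, symmetric `b`, an equilibrium `δ⁰` with the PSD + kernel certificate
(no arc / sign hypothesis): `ρ, k, λ > 0` with
`‖X(t) − (δ⁰ + c𝟙, 0)‖ ≤ k‖X(0) − (δ⁰ + c𝟙, 0)‖e^{−λt}` for every solution of `X' = spField X` on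
`[0, T]` with `‖X(0) − (δ⁰, 0)‖ < ρ`.
[cite: ManikTimmeWitthaut2017, §2 Lemma 1 (stable direction, «power grid model»);
DorflerChertkovBullo2013, SI §3.1 Lemma 1 (ii) with Lemma 2 (2)] -/
theorem expStable_modRotation_of_posCurvature (hM : ∀ i, 0 ≤ S.M i) (hD : ∀ i, 0 < S.D i)
    (hb : ∀ i j, S.b i j = S.b j i) {δ0 : Fin n → ℝ} (hδ0 : S.IsEquilibrium δ0)
    (hpsd : ∀ u : Fin n → ℝ, 0 ≤ ∑ i, u i * ∑ j, S.toDroopNetwork.linWeight δ0 i j * (u i - u j))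
    (hker : ∀ u : Fin n → ℝ, ∑ i, u i * ∑ j, S.toDroopNetwork.linWeight δ0 i j * (u i - u j) = 0 →
      ∃ a : ℝ, u = fun _ => a) :
    ∃ ρ > 0, ∃ k > 0, ∃ lam > 0, ∀ (X : ℝ → Fin n ⊕ S.Gen → ℝ) (T : ℝ),
      (∀ t ∈ Icc 0 T, HasDerivWithinAt X (S.spField (X t)) (Icc 0 T) t) →
      ‖X 0 - S.phase δ0 (fun _ => 0)‖ < ρ →
      ∀ t ∈ Icc 0 T,
        ‖X t - fun k => S.phase δ0 (fun _ => 0) k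
            + S.weights ⬝ᵥ (X 0 - S.phase δ0 (fun _ => 0)) / (∑ i, S.D i) * S.rot k‖
          ≤ k * ‖X 0 - fun k => S.phase δ0 (fun _ => 0) k
              + S.weights ⬝ᵥ (X 0 - S.phase δ0 (fun _ => 0)) / (∑ i, S.D i) * S.rot k‖
            * Real.exp (-lam * t) := by
  obtain ⟨ρ, hρ, k, hk, lam, hlam, H⟩ :=
    expStable_within_leaf_of_posCurvature hM hD hb hδ0 hpsd hker
  have hK0 : 0 ≤ (∑ k, S.weights k) / ∑ i, S.D i :=
    div_nonneg (Finset.sum_nonneg fun k _ => by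
      cases k with
      | inl i => exact (hD i).le
      | inr g => exact hM g.1) (Finset.sum_nonneg fun i _ => (hD i).le)
  exact ⟨ρ / (1 + (∑ k, S.weights k) / ∑ i, S.D i), by positivity, k, hk, lam, hlam,
    expStable_modRotation_of_within_leaf hM hD H⟩

/-- **A solution of the structure-preserving equations is a solution of `X' = spField X`** (the
state `X = (δ, v_G)`; load-bus speeds are eliminated by their algebraic row).  `M_i ≥ 0`, `D_i > 0`.
[cite: Padiyar2013, §3.2 eq. (3.2); DorflerChertkovBullo2013, SI §2.4] -/
theorem hasDerivAt_phase_of_isSolutionAt (hM : ∀ i, 0 ≤ S.M i) (hD : ∀ i, 0 < S.D i)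
    {δ v : ℝ → Fin n → ℝ} (hsol : ∀ t, S.IsSolutionAt δ v t) (s : ℝ) :
    HasDerivAt (fun s => S.phase (δ s) (fun g => v s g.1))
      (S.spField (S.phase (δ s) (fun g => v s g.1))) s := by
  rw [hasDerivAt_pi]
  intro k
  cases k with
  | inl i =>
    obtain ⟨a, hδ', hv', hrow⟩ := hsol s i
    by_cases hi : 0 < S.M i
    · have : S.spField (S.phase (δ s) (fun g => v s g.1)) (Sum.inl i) = v s i := by
        simp [phase, spField, hi, genSpeed]
      rw [this]
      simpa [phase] using hδ'
    · have hM0 : S.M i = 0 := le_antisymm (not_lt.1 hi) (hM i)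
      have hvs : v s i = (S.P0 i - S.flow (δ s) i) / S.D i := by
        rw [hM0, zero_mul, zero_add] at hrow
        field_simp [(hD i).ne']
        linarith
      have : S.spField (S.phase (δ s) (fun g => v s g.1)) (Sum.inl i)
          = (S.P0 i - S.flow (δ s) i) / S.D i := by
        simp [phase, spField, hi]
      rw [this, ← hvs]
      simpa [phase] using hδ'
  | inr g =>
    obtain ⟨a, hδ', hv', hrow⟩ := hsol s g.1
    have ha : a = (S.P0 g.1 - S.D g.1 * v s g.1 - S.flow (δ s) g.1) / S.M g.1 := by
      field_simp [g.2.ne']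
      linarith
    have : S.spField (S.phase (δ s) (fun g => v s g.1)) (Sum.inr g) = a := by
      rw [ha]; simp [phase, spField]
    rw [this]
    simpa [phase] using hv'

/-- **From the state-space estimate to the tree's solution notion** — the bookkeeping of
`syncEquilibrium_locally_expStable` with the modulo-rotation estimate taken as a hypothesis `H`.
[cite: DorflerChertkovBullo2013, SI §3.1 Lemma 1 (ii) with Lemma 2 (2); Padiyar2013, §3.2 eq. (3.2)] -/
theorem syncEquilibrium_expStable_of_modRotation (hM : ∀ i, 0 ≤ S.M i) (hD : ∀ i, 0 < S.D i)
    {δ0 : Fin n → ℝ} {ρ k lam : ℝ}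
    (H : ∀ (X : ℝ → Fin n ⊕ S.Gen → ℝ) (T : ℝ),
      (∀ t ∈ Icc 0 T, HasDerivWithinAt X (S.spField (X t)) (Icc 0 T) t) →
      ‖X 0 - S.phase δ0 (fun _ => 0)‖ < ρ →
      ∀ t ∈ Icc 0 T,
        ‖X t - fun k => S.phase δ0 (fun _ => 0) k
            + S.weights ⬝ᵥ (X 0 - S.phase δ0 (fun _ => 0)) / (∑ i, S.D i) * S.rot k‖
          ≤ k * ‖X 0 - fun k => S.phase δ0 (fun _ => 0) k
              + S.weights ⬝ᵥ (X 0 - S.phase δ0 (fun _ => 0)) / (∑ i, S.D i) * S.rot k‖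
            * Real.exp (-lam * t)) :
    ∀ δ v : ℝ → Fin n → ℝ, (∀ t, S.IsSolutionAt δ v t) →
      ‖S.phase (δ 0 - δ0) (fun g => v 0 g.1)‖ < ρ →
      ∀ t : ℝ, 0 ≤ t →
        ‖S.phase (fun i => δ t i - (δ0 i
              + (∑ j, S.D j * (δ 0 j - δ0 j) + ∑ g : S.Gen, S.M g.1 * v 0 g.1) / ∑ j, S.D j))
            (fun g => v t g.1)‖
          ≤ k * ‖S.phase (fun i => δ 0 i - (δ0 i
              + (∑ j, S.D j * (δ 0 j - δ0 j) + ∑ g : S.Gen, S.M g.1 * v 0 g.1) / ∑ j, S.D j))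
            (fun g => v 0 g.1)‖ * Real.exp (-lam * t) := by
  intro δ v hsol h0 t ht
  set X : ℝ → Fin n ⊕ S.Gen → ℝ := fun s => S.phase (δ s) (fun g => v s g.1) with hXdef
  have hXsol : ∀ s ∈ Icc 0 t, HasDerivWithinAt X (S.spField (X s)) (Icc 0 t) s :=
    fun s _ => (hasDerivAt_phase_of_isSolutionAt hM hD hsol s).hasDerivWithinAt
  have hdev : X 0 - S.phase δ0 (fun _ => 0) = S.phase (δ 0 - δ0) (fun g => v 0 g.1) := by
    funext k
    cases k with
    | inl i => simp [hXdef, phase]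
    | inr g => simp [hXdef, phase]
  have hc : S.weights ⬝ᵥ (X 0 - S.phase δ0 (fun _ => 0))
      = ∑ j, S.D j * (δ 0 j - δ0 j) + ∑ g : S.Gen, S.M g.1 * v 0 g.1 := by
    rw [hdev]
    simp [dotProduct, Fintype.sum_sum_type, weights, phase]
  have key := H X t hXsol (by rw [hdev]; exact h0) t ⟨ht, le_rfl⟩
  rw [hc] at key
  have hshape : ∀ s, (X s - fun k => S.phase δ0 (fun _ => 0) k
      + (∑ j, S.D j * (δ 0 j - δ0 j) + ∑ g : S.Gen, S.M g.1 * v 0 g.1) / (∑ i, S.D i) * S.rot k)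
      = S.phase (fun i => δ s i - (δ0 i
          + (∑ j, S.D j * (δ 0 j - δ0 j) + ∑ g : S.Gen, S.M g.1 * v 0 g.1) / ∑ j, S.D j))
        (fun g => v s g.1) := fun s => by
    funext k
    cases k with
    | inl i => simp [hXdef, phase, rot]
    | inr g => simp [hXdef, phase, rot]
  rw [hshape t, hshape 0] at key
  exact key

/-- **MTW2017 Lemma 1, stable clause, for the structure-preserving (Bergen–Hill) model in the tree's
solution notion — a transversal strict local minimum of the potential energy is locally
exponentially stable modulo the uniform rotation.**  `M_i ≥ 0` (generators `M_i > 0`, load buses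
`M_i = 0`), `D_i > 0`, symmetric `b` (NO sign condition), an equilibrium `δ⁰`
(`Σ_j b_ij sin(δ⁰_i − δ⁰_j) = P⁰_i`) — in the arc OR NOT — at which the real Hessian form
`u ↦ Σ_i u_i Σ_j b_ij cos(δ⁰_i − δ⁰_j)(u_i − u_j)` is `≥ 0` with kernel the constants (e.g.
`posCurvature_of_arc`, or an exact LDLᵀ certificate for a loop flow with a line beyond `π/2`).  Then
there are `ρ, k, λ > 0` such that every solution `(δ, v)` (`IsSolutionAt` at every time) with
`‖(δ(0) − δ⁰, v_G(0))‖ < ρ` satisfies, for all `t ≥ 0`,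
`‖(δ(t) − (δ⁰ + c𝟙), v_G(t))‖ ≤ k‖(δ(0) − (δ⁰ + c𝟙), v_G(0))‖e^{−λt}`,
`c = (Σ_i D_i(δ_i(0) − δ⁰_i) + Σ_{gen} M_iv_i(0))/Σ_i D_i`.  MODEL: structure-preserving model,
lossless, frequency-dependent loads; `ρ, k, λ` existential.
[cite: ManikTimmeWitthaut2017, §2 Lemma 1 (stable direction, «power grid model»);
DorflerChertkovBullo2013, SI §3.1 Lemma 1 (ii) with Lemma 2 (2); Padiyar2013, §3.2 eq. (3.2)] -/
theorem syncEquilibrium_locally_expStable_of_posCurvature (hM : ∀ i, 0 ≤ S.M i)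
    (hD : ∀ i, 0 < S.D i) (hb : ∀ i j, S.b i j = S.b j i) {δ0 : Fin n → ℝ}
    (hδ0 : S.IsEquilibrium δ0)
    (hpsd : ∀ u : Fin n → ℝ, 0 ≤ ∑ i, u i * ∑ j, S.toDroopNetwork.linWeight δ0 i j * (u i - u j))
    (hker : ∀ u : Fin n → ℝ, ∑ i, u i * ∑ j, S.toDroopNetwork.linWeight δ0 i j * (u i - u j) = 0 →
      ∃ a : ℝ, u = fun _ => a) :
    ∃ ρ > 0, ∃ k > 0, ∃ lam > 0, ∀ δ v : ℝ → Fin n → ℝ, (∀ t, S.IsSolutionAt δ v t) →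
      ‖S.phase (δ 0 - δ0) (fun g => v 0 g.1)‖ < ρ →
      ∀ t : ℝ, 0 ≤ t →
        ‖S.phase (fun i => δ t i - (δ0 i
              + (∑ j, S.D j * (δ 0 j - δ0 j) + ∑ g : S.Gen, S.M g.1 * v 0 g.1) / ∑ j, S.D j))
            (fun g => v t g.1)‖
          ≤ k * ‖S.phase (fun i => δ 0 i - (δ0 i
              + (∑ j, S.D j * (δ 0 j - δ0 j) + ∑ g : S.Gen, S.M g.1 * v 0 g.1) / ∑ j, S.D j))
            (fun g => v 0 g.1)‖ * Real.exp (-lam * t) := by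
  obtain ⟨ρ, hρ, k, hk, lam, hlam, H⟩ :=
    expStable_modRotation_of_posCurvature hM hD hb hδ0 hpsd hker
  exact ⟨ρ, hρ, k, hk, lam, hlam, syncEquilibrium_expStable_of_modRotation hM hD H⟩

end BergenHill

end Literature.MathematicalPhysics.PowerSystems
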